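import Literature.NumberTheory.Transcendental.KZLogCalculus
import Literature.NumberTheory.Transcendental.KZUnfolding
import Literature.NumberTheory.Transcendental.KZIntervalPeriodProofs
import Literature.NumberTheory.Transcendental.SemialgebraicMapsSmoothProofs
import Literature.NumberTheory.Transcendental.SemialgebraicVolume
import Literature.ModelTheory.ExponentialFields.SemialgebraicInterior
import HarnessLib

/-!
# Conservativity of the logarithmic Kontsevich–Zagier calculus: `KZlog.Conservative_holds`

`KZLogCalculus.lean` fixes the syntactic logarithmic calculus `KZlog` (terms
`[σ; h₀; (hᵢ, vᵢ)ᵢ]` standing for `∫_σ (h₀ + Σ hᵢ log vᵢ)`, nine moves) over the Kontsevich–Zagier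
calculus `KZ` of `KZCalculus.lean` (representations `[σ, f]`, four moves), the inclusion
`incl : KZ.FormalRep →+ KZlog.FormalRep` and the UNFOLDING `unfold : KZlog.FormalRep →+ KZ.FormalRep`,
`[σ; h₀; (hᵢ, vᵢ)ᵢ] ↦ [σ, h₀] + Σᵢ [{(x, s) | x ∈ σ, 1 ≤ s ≤ vᵢ x}, hᵢ(x)/s]` (`log v = ∫₁^v ds/s`,
Kontsevich–Zagier 2001, §1.1), and registers `KZlog.Conservative` — "`incl c ∈ KZlog.relations →
c ∈ KZ.relations`" — as an open route statement, proving there that it is EQUIVALENT to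
`KZlog.moves ⊆ unfold ⁻¹' KZ.relations` (`KZlog.conservative_iff_moves_subset`).

This file PROVES `KZlog.Conservative` (`KZlog.Conservative_holds`): the unfolding of each of the
nine logarithmic moves is derivable from the four moves of the KZ calculus. For the additivity
moves (1a), (1b) and the rewrites (ii)–(v) this is bookkeeping (domain/integrand additivity, null
domains and zero integrands are relations: `KZUnfolding.lean`). The content lies in three engines,
all obtained from Kontsevich–Zagier's rules 1)–3) together with the smoothness of semialgebraic
functions off a Lebesgue-null semialgebraic set (`IsSemialgebraicFunOn.exists_contDiffOn_holds`,
Bochnak–Coste–Roy 1998, §2.9; frontiers and thin semialgebraic sets are null,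
`SemialgebraicVolume.lean`) — NO cylindrical decomposition is needed:

* **affine substitution along the last coordinate** (`KZ.of_sub_of_mem_relations_of_affine`):
  `(y, s) ↦ (y, α y + β y · s)` over an open semialgebraic base on which `α, β` are differentiable,
  `β > 0`, is a change-of-variables move (rule 2); Jacobian `β y`, `LinearMap.det_of_snoc_init`);
* **fibrewise substitution** `s = 1 + θ (v − 1)` (`KZ.of_sub_of_mem_relations_fibreSubst`):
  `[{1 ≤ s ≤ v}, f/s] ∼ [{0 ≤ θ ≤ 1}, f (v − 1)/(1 + θ (v − 1))]` for merely semialgebraic `v ≥ 1`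
  (split the base into the open set where `v` is smooth and `> 1`, the interior of `{v = 1}` where
  both sides are junk, and a null remainder), and the **product rule**
  `[{1 ≤ t ≤ u w}, g/t] ∼ [{1 ≤ t ≤ u}, g/t] + [{1 ≤ s ≤ w}, g/s]` (`KZ.of_sub_of_sub_mem_relations_mul`,
  substitution `t = u s` on the smooth locus of `u`);
* **the unfolded logarithmic Stokes formula** (`KZlog.unfold_newtonLeibniz_monomial_mem`), i.e. the
  unfolding of `∫_a^b (H' log V + H V'/V) dt = [H log V]_a^b`: with `c = V − 1`, `S = 1 + θ c` on the
  box `B × [0, 1]`, the monomial `[{1 ≤ s ≤ V}, H'/s]` is `[box, H' c/S]` (fibrewise substitution),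
  `[box, H V'/S²] − [B, H V'/V]` is ONE Newton–Leibniz move along `θ` (primitive `H V' θ/S`), and on
  the box with `t` LAST (a coordinate permutation, rule 2)) `H' c/S + H V'/S² = ∂ₜ (H c/S)`, so ONE
  Newton–Leibniz move along `t` (rule 3); the `t`-fibres `[a x, b x]` of the box are intervals) lands
  on `[τ × [0,1], K(x, b x, θ) − K(x, a x, θ)]`, `K = H c/S`, whose two halves are the unfolded
  boundary monomials by fibrewise substitution again.

Sources: M. Kontsevich, D. Zagier, *Periods* (2001), §1.1 ("introducing more variables";
`log 2 = ∫₁² dx/x`) and §1.2 (rules 1)–3)) [KontsevichZagierPeriods2001]; J. Bochnak, M. Coste,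
M.-F. Roy, *Real Algebraic Geometry* (1998), §2.2, §2.9 [BochnakCosteRoy1998]. The statement
`KZlog.Conservative` itself is posed by route KontsevichZagierPeriods/LiouvilleUnfolding of this
project (item LogCalculusConservative; its Newton–Leibniz part is the route's crux
UnfoldedLogStokes) and is not in print; the derivations in this file are this project's.

Design: theorems only (no new definitions); intermediate representations are anonymous
`KZ.IntegralRep` structures or are obtained from existence lemmas stating their domain and
integrand.
-/

noncomputable section

open MeasureTheory Set Filter
open scoped BigOperators Topology ContDiff

namespace Literature.NumberTheory.Transcendental

open Literature.ModelTheory.ExponentialFields (IsSemialgebraic)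

variable {n m : ℕ}

/-! ### A determinant: maps `w ↦ (A w', ℓ w' + c · w_last)`, `w' = init w` -/

/-- For a linear map `T` of `ℝᵐ⁺¹` of the shape `T w = (A (init w), ℓ (init w) + c · w last)`
(block lower-triangular with respect to `ℝᵐ⁺¹ = ℝᵐ × ℝ`), `det T = c · det A` (Laplace expansion
along the last column). [folklore] -/
theorem LinearMap.det_of_snoc_init {m : ℕ} (T : (Fin (m + 1) → ℝ) →ₗ[ℝ] (Fin (m + 1) → ℝ))
    (A : (Fin m → ℝ) →ₗ[ℝ] (Fin m → ℝ)) (ℓ : (Fin m → ℝ) →ₗ[ℝ] ℝ) (c : ℝ)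
    (hT : ∀ w, T w = Fin.snoc (A (Fin.init w)) (ℓ (Fin.init w) + c * w (Fin.last m))) :
    LinearMap.det T = c * LinearMap.det A := by
  classical
  have hinit_last : Fin.init (Pi.single (Fin.last m) (1 : ℝ) : Fin (m + 1) → ℝ) = 0 := by
    ext i
    simp [Fin.init, (Fin.castSucc_lt_last i).ne]
  have hinit_cs : ∀ j : Fin m,
      Fin.init (Pi.single (Fin.castSucc j) (1 : ℝ) : Fin (m + 1) → ℝ) = Pi.single j 1 := by
    intro j
    ext i
    simp [Fin.init, Pi.single_apply, Fin.castSucc_inj]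
  have hM : ∀ i j, LinearMap.toMatrix' T i j = T (Pi.single j 1) i := fun i j =>
    LinearMap.toMatrix'_apply T i j
  rw [← LinearMap.det_toMatrix' (f := T), Matrix.det_succ_column _ (Fin.last m),
    Fin.sum_univ_castSucc]
  have hcol_cs : ∀ i : Fin m, LinearMap.toMatrix' T (Fin.castSucc i) (Fin.last m) = 0 := by
    intro i
    rw [hM, hT, hinit_last]
    simp
  have hcol_last : LinearMap.toMatrix' T (Fin.last m) (Fin.last m) = c := by
    rw [hM, hT, hinit_last]
    simp
  have hsub : (LinearMap.toMatrix' T).submatrix (Fin.last m).succAbove (Fin.last m).succAbove =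
      LinearMap.toMatrix' A := by
    ext i j
    simp only [Matrix.submatrix_apply, Fin.succAbove_last, hM, LinearMap.toMatrix'_apply, hT,
      hinit_cs, Fin.snoc_castSucc]
  simp only [hcol_cs, mul_zero, zero_mul, Finset.sum_const_zero, zero_add, hcol_last, hsub,
    LinearMap.det_toMatrix']
  rw [Even.neg_one_pow ⟨_, rfl⟩, one_mul]

namespace KZ

/-! ### Junk and congruence in the KZ calculus -/

/-- A representation over a null domain is a relation (`KZ.of_mem_levelRel_of_volume_eq_zero`).
[Kontsevich–Zagier 2001, §1.2, rule 1)] [folklore] -/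
theorem of_mem_relations_of_volume_eq_zero (r : IntegralRep n) (h : volume r.domain = 0) :
    of r ∈ relations :=
  levelRel_le_relations (of_mem_levelRel_of_volume_eq_zero r h)

/-- A representation whose integrand vanishes on its domain is a relation
(`KZ.of_mem_levelRel_of_eqOn_zero`). [Kontsevich–Zagier 2001, §1.2, rule 1)] [folklore] -/
theorem of_mem_relations_of_eqOn_zero (r : IntegralRep n) (h : EqOn r.integrand 0 r.domain) :
    of r ∈ relations :=
  levelRel_le_relations (of_mem_levelRel_of_eqOn_zero r h)

/-- The zero representation on a semialgebraic set. [folklore] -/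
theorem exists_zeroRep {σ : Set (Fin n → ℝ)} (hσ : IsSemialgebraic ℚ σ) :
    ∃ z : IntegralRep n, z.domain = σ ∧ z.integrand = 0 :=
  ⟨⟨σ, 0, hσ, (isSemialgebraicFunOn_aeval hσ 0).congr fun x _ => by simp, integrableOn_zero⟩,
    rfl, rfl⟩

/-- **Congruence**: two representations with the same domain whose integrands agree ON the domain
differ by a relation (integrand additivity with a zero representation).
[Kontsevich–Zagier 2001, §1.2, rule 1)] [folklore] -/
theorem of_sub_of_mem_relations_of_eqOn {r r' : IntegralRep n} (hd : r'.domain = r.domain)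
    (h : EqOn r.integrand r'.integrand r.domain) : of r - of r' ∈ relations := by
  obtain ⟨z, hzd, hzi⟩ := exists_zeroRep r.isSemialgebraic_domain
  have h1 : of r - of r' - of z ∈ relations :=
    integrandAddRel_subset_relations ⟨n, r, r', z, hd, hzd, fun x hx => by
      simp [hzi, h hx], rfl⟩
  have h2 : of z ∈ relations := of_mem_relations_of_eqOn_zero z (by simp [hzi, EqOn])
  have : of r - of r' = (of r - of r' - of z) + of z := by abel
  rw [this]
  exact relations.add_mem h1 h2

/-- Two representations with the same domain and opposite integrands on it sum to a relation.
[Kontsevich–Zagier 2001, §1.2, rule 1)] [folklore] -/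
theorem of_add_of_mem_relations_of_eqOn_neg {r r' : IntegralRep n} (hd : r'.domain = r.domain)
    (h : EqOn r'.integrand (-r.integrand) r.domain) : of r + of r' ∈ relations := by
  have h1 : of r + of r.neg ∈ relations := levelRel_le_relations (of_add_of_neg_mem_levelRel r)
  have h2 : of r.neg - of r' ∈ relations :=
    of_sub_of_mem_relations_of_eqOn (by simp [hd]) (fun x hx => (h hx).symm)
  have : of r + of r' = (of r + of r.neg) - (of r.neg - of r') := by abel
  rw [this]
  exact relations.sub_mem h1 h2

/-! ### Null sets -/

/-- A cylinder over a null base is null. [folklore] -/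
theorem volume_setOf_init_mem_eq_zero {N : Set (Fin n → ℝ)} (hN : volume N = 0) :
    volume {z : Fin (n + 1) → ℝ | Fin.init z ∈ N} = 0 := by
  obtain ⟨N', hNN', hN'm, hN'⟩ := exists_measurable_superset_of_null hN
  set e : (Fin (n + 1) → ℝ) ≃ᵐ ℝ × (Fin n → ℝ) :=
    MeasurableEquiv.piFinSuccAbove (fun _ => ℝ) (Fin.last n) with he_def
  have he : MeasurePreserving e volume volume :=
    volume_preserving_piFinSuccAbove (fun _ => ℝ) (Fin.last n)
  have he2 : ∀ z : Fin (n + 1) → ℝ, (e z).2 = Fin.init z := fun z => by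
    ext i
    simp [he_def, MeasurableEquiv.piFinSuccAbove, Fin.init]
  have hsub : {z : Fin (n + 1) → ℝ | Fin.init z ∈ N} ⊆ e ⁻¹' (univ ×ˢ N') := fun z hz => by
    simp only [mem_preimage, mem_prod, mem_univ, true_and, he2]
    exact hNN' hz
  refine measure_mono_null hsub ?_
  rw [he.measure_preimage (MeasurableSet.univ.prod hN'm).nullMeasurableSet,
    Measure.volume_eq_prod, Measure.prod_prod, hN', mul_zero]

/-- A coordinate hyperplane `{z | z last = c}` is null. [folklore] -/
theorem volume_setOf_last_eq_zero (c : ℝ) :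
    volume {z : Fin (n + 1) → ℝ | z (Fin.last n) = c} = 0 := by
  rw [volume_pi]
  exact Measure.pi_hyperplane _ _ _

/-- The graph of a semialgebraic function is null (Tonelli: its fibres are points). [folklore] -/
theorem volume_graph_eq_zero {σ : Set (Fin n → ℝ)} {u : (Fin n → ℝ) → ℝ}
    (hu : IsSemialgebraicFunOn ℚ σ u) :
    volume {z : Fin (n + 1) → ℝ | Fin.init z ∈ σ ∧ z (Fin.last n) = u (Fin.init z)} = 0 := by
  have hmeas : MeasurableSet
      {z : Fin (n + 1) → ℝ | Fin.init z ∈ σ ∧ z (Fin.last n) = u (Fin.init z)} :=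
    IsSemialgebraic.measurableSet_holds (isSemialgebraicFunOn_iff.mp hu)
  set e : (Fin (n + 1) → ℝ) ≃ᵐ ℝ × (Fin n → ℝ) :=
    MeasurableEquiv.piFinSuccAbove (fun _ => ℝ) (Fin.last n) with he_def
  have he : MeasurePreserving e volume volume :=
    volume_preserving_piFinSuccAbove (fun _ => ℝ) (Fin.last n)
  have he_symm : ∀ p : ℝ × (Fin n → ℝ), e.symm p = Fin.snoc p.2 p.1 := fun p => by
    simp [he_def, MeasurableEquiv.piFinSuccAbove, Fin.snocEquiv]
  set S := {z : Fin (n + 1) → ℝ | Fin.init z ∈ σ ∧ z (Fin.last n) = u (Fin.init z)} with hS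
  have hS' : MeasurableSet (e.symm ⁻¹' S) := e.symm.measurable hmeas
  calc volume S = volume (e.symm ⁻¹' S) :=
        ((he.symm e).measure_preimage hmeas.nullMeasurableSet).symm
    _ = (volume : Measure ℝ).prod (volume : Measure (Fin n → ℝ)) (e.symm ⁻¹' S) := by
        rw [Measure.volume_eq_prod]
    _ = ∫⁻ y, volume ((fun t : ℝ => (t, y)) ⁻¹' (e.symm ⁻¹' S)) := Measure.prod_apply_symm hS'
    _ = ∫⁻ _ : Fin n → ℝ, (0 : ENNReal) := by
        refine lintegral_congr fun y => ?_
        have : (fun t : ℝ => (t, y)) ⁻¹' (e.symm ⁻¹' S) ⊆ {u y} := fun t ht => by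
          simp only [mem_preimage, he_symm, hS, mem_setOf_eq, Fin.init_snoc, Fin.snoc_last] at ht
          exact ht.2
        exact measure_mono_null this (measure_singleton _)
    _ = 0 := lintegral_zero

/-- A `ℚ`-semialgebraic set with empty interior is null: it is covered by finitely many zero sets
of non-zero polynomials (`IsSemialgebraic.subset_interior_union`, `volume_setOf_aeval_eq_zero`).
[Bochnak–Coste–Roy 1998, §2.8] [folklore] -/
theorem volume_eq_zero_of_interior_eq_empty {Z : Set (Fin n → ℝ)} (hZ : IsSemialgebraic ℚ Z)
    (hint : interior Z = ∅) : volume Z = 0 := by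
  obtain ⟨Q₀, hQ₀, hsub⟩ := hZ.subset_interior_union
  rw [hint, empty_union] at hsub
  refine measure_mono_null hsub ((measure_biUnion_null_iff Q₀.countable_toSet).2 fun q hq => ?_)
  obtain ⟨x, hx⟩ := hQ₀ q hq
  refine volume_setOf_aeval_eq_zero q fun h0 => hx ?_
  rw [MvPolynomial.aeval_def, ← MvPolynomial.eval_map, h0, map_zero]

/-- **Smoothness of a semialgebraic function off a null semialgebraic set**: for `v`
`ℚ`-semialgebraic on a `ℚ`-semialgebraic `D ⊆ ℝⁿ` there is an open `ℚ`-semialgebraic `G ⊆ D` on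
which `v` is `C^∞`, with `D \ G` `ℚ`-semialgebraic and null (`G` = interior of `D` minus the thin
singular set of `IsSemialgebraicFunOn.exists_contDiffOn_holds`; the frontier of `D` is null).
[Bochnak–Coste–Roy 1998, §2.9] [folklore] -/
theorem exists_isOpen_contDiffOn {D : Set (Fin n → ℝ)} {v : (Fin n → ℝ) → ℝ}
    (hD : IsSemialgebraic ℚ D) (hv : IsSemialgebraicFunOn ℚ D v) :
    ∃ G : Set (Fin n → ℝ), G ⊆ D ∧ IsOpen G ∧ IsSemialgebraic ℚ G ∧ ContDiffOn ℝ ∞ v G ∧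
      IsSemialgebraic ℚ (D \ G) ∧ volume (D \ G) = 0 := by
  have hD₀ : IsSemialgebraic ℚ (interior D) :=
    Literature.ModelTheory.ExponentialFields.isSemialgebraic_interior hD
  have hv₀ : IsSemialgebraicFunOn ℚ (interior D) v := hv.mono interior_subset hD₀
  obtain ⟨Z, -, hZ, hZint, hopen, hsmooth⟩ :=
    IsSemialgebraicFunOn.exists_contDiffOn_holds (k := ℚ) isOpen_interior hv₀
  refine ⟨interior D \ Z, fun x hx => interior_subset hx.1, hopen, hD₀.diff hZ, hsmooth,
    hD.diff (hD₀.diff hZ), ?_⟩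
  have hsub : D \ (interior D \ Z) ⊆ frontier D ∪ Z := by
    intro x hx
    by_cases hxZ : x ∈ Z
    · exact Or.inr hxZ
    · exact Or.inl ⟨subset_closure hx.1, fun hxi => hx.2 ⟨hxi, hxZ⟩⟩
  exact measure_mono_null hsub (measure_union_null (volume_frontier_eq_zero_of_isSemialgebraic hD)
    (volume_eq_zero_of_interior_eq_empty hZ hZint))

/-! ### Bands -/

/-- A band over a union of bases is the union of the bands. [folklore] -/
theorem band_union {s t : Set (Fin m → ℝ)} {a b : (Fin m → ℝ) → ℝ} :
    KZlog.band (s ∪ t) a b = KZlog.band s a b ∪ KZlog.band t a b := by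
  ext z
  simp only [KZlog.band, mem_setOf_eq, mem_union]
  tauto

/-- Bands over disjoint bases are disjoint. [folklore] -/
theorem band_inter_band_eq_empty {s t : Set (Fin m → ℝ)} {a b a' b' : (Fin m → ℝ) → ℝ}
    (h : s ∩ t = ∅) : KZlog.band s a b ∩ KZlog.band t a' b' = ∅ := by
  ext z
  simp only [KZlog.band, mem_inter_iff, mem_setOf_eq, mem_empty_iff_false, iff_false, not_and,
    and_imp]
  intro hs _ _ ht
  have : Fin.init z ∈ s ∩ t := ⟨hs, ht⟩
  rw [h] at this
  exact fun _ _ => this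

/-- A band is contained in the cylinder over its base. [folklore] -/
theorem band_subset_setOf_init_mem {s : Set (Fin m → ℝ)} {a b : (Fin m → ℝ) → ℝ} :
    KZlog.band s a b ⊆ {z | Fin.init z ∈ s} := fun _ hz => hz.1

/-- A semialgebraic function of the base, seen on a subset of the cylinder. [folklore] -/
theorem _root_.Literature.NumberTheory.Transcendental.IsSemialgebraicFunOn.comp_init_mono
    {s : Set (Fin m → ℝ)} {f : (Fin m → ℝ) → ℝ} (hf : IsSemialgebraicFunOn ℚ s f)
    {B : Set (Fin (m + 1) → ℝ)} (hB : IsSemialgebraic ℚ B) (hBs : B ⊆ {z | Fin.init z ∈ s}) :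
    IsSemialgebraicFunOn ℚ B (fun z => f (Fin.init z)) :=
  hf.comp_init.mono hBs hB

/-- **Splitting a representation over a band along a two-piece decomposition of the base**
(domain additivity; bands over disjoint bases are disjoint). [Kontsevich–Zagier 2001, §1.2,
rule 1)] [folklore] -/
theorem exists_split_band (R : IntegralRep (m + 1)) {D s t : Set (Fin m → ℝ)}
    {a b : (Fin m → ℝ) → ℝ} (hR : R.domain = KZlog.band D a b) (hst : D = s ∪ t) (hdisj : s ∩ t = ∅)
    (hs : IsSemialgebraic ℚ s) (ht : IsSemialgebraic ℚ t) (ha : IsSemialgebraicFunOn ℚ D a)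
    (hb : IsSemialgebraicFunOn ℚ D b) :
    ∃ Rs Rt : IntegralRep (m + 1), Rs.domain = KZlog.band s a b ∧ Rs.integrand = R.integrand ∧
      Rt.domain = KZlog.band t a b ∧ Rt.integrand = R.integrand ∧
      of R - of Rs - of Rt ∈ relations := by
  have hsD : s ⊆ D := hst ▸ subset_union_left
  have htD : t ⊆ D := hst ▸ subset_union_right
  have hbs : IsSemialgebraic ℚ (KZlog.band s a b) :=
    KZlog.isSemialgebraic_band (ha.mono hsD hs) (hb.mono hsD hs)
  have hbt : IsSemialgebraic ℚ (KZlog.band t a b) :=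
    KZlog.isSemialgebraic_band (ha.mono htD ht) (hb.mono htD ht)
  have hsub_s : KZlog.band s a b ⊆ R.domain := fun z hz => hR ▸ ⟨hsD hz.1, hz.2⟩
  have hsub_t : KZlog.band t a b ⊆ R.domain := fun z hz => hR ▸ ⟨htD hz.1, hz.2⟩
  refine ⟨R.restrict _ hbs hsub_s, R.restrict _ hbt hsub_t, rfl, rfl, rfl, rfl, ?_⟩
  refine domainAddRel_subset_relations ⟨m + 1, R, R.restrict _ hbs hsub_s, R.restrict _ hbt hsub_t,
    ?_, ?_, fun _ _ => rfl, fun _ _ => rfl, rfl⟩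
  · rw [IntegralRep.domain_restrict, IntegralRep.domain_restrict, ← band_union, ← hst, hR]
  · rw [IntegralRep.domain_restrict, IntegralRep.domain_restrict, band_inter_band_eq_empty hdisj,
      measure_empty]

/-! ### Affine substitution along the last coordinate -/

/-- **Affine substitution along the last coordinate is a change-of-variables move.** Over an open
`ℚ`-semialgebraic base `G ⊆ ℝᵐ` let `α, β` be `ℚ`-semialgebraic and differentiable with `β > 0`. For
a representation `r` on the band `{(y, s) | y ∈ G, a y ≤ s ≤ b y}` and a representation `r'` on the
band with edges `a' = α + β a`, `b' = α + β b` such that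
`r.integrand (y, s) = r'.integrand (y, α y + β y s) · β y` on `r.domain`, `[r] − [r']` is an
instance of Kontsevich–Zagier's rule 2) along `Φ (y, s) = (y, α y + β y s)` (`ℚ`-semialgebraic,
injective, differentiable with Jacobian determinant `β y`, `LinearMap.det_of_snoc_init`), hence a
relation. [Kontsevich–Zagier 2001, §1.2, rule 2)] [folklore] -/
theorem of_sub_of_mem_relations_of_affine {m : ℕ} {G : Set (Fin m → ℝ)} (hGo : IsOpen G)
    {α β a b a' b' : (Fin m → ℝ) → ℝ}
    (hα : IsSemialgebraicFunOn ℚ G α) (hβ : IsSemialgebraicFunOn ℚ G β)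
    (hαd : DifferentiableOn ℝ α G) (hβd : DifferentiableOn ℝ β G) (hβpos : ∀ y ∈ G, 0 < β y)
    (r r' : IntegralRep (m + 1)) (hr : r.domain = KZlog.band G a b)
    (hr' : r'.domain = KZlog.band G a' b')
    (ha' : ∀ y ∈ G, a' y = α y + β y * a y) (hb' : ∀ y ∈ G, b' y = α y + β y * b y)
    (hint : ∀ z ∈ r.domain, r.integrand z =
      r'.integrand (Fin.snoc (Fin.init z) (α (Fin.init z) + β (Fin.init z) * z (Fin.last m))) *
        β (Fin.init z)) :
    of r - of r' ∈ relations := by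
  have hmemG : ∀ z ∈ r.domain, Fin.init z ∈ G := fun z hz => by
    rw [hr] at hz
    exact hz.1
  have hαd' : ∀ y ∈ G, HasFDerivAt α (fderiv ℝ α y) y := fun y hy =>
    ((hαd y hy).differentiableAt (hGo.mem_nhds hy)).hasFDerivAt
  have hβd' : ∀ y ∈ G, HasFDerivAt β (fderiv ℝ β y) y := fun y hy =>
    ((hβd y hy).differentiableAt (hGo.mem_nhds hy)).hasFDerivAt
  -- the substitution
  set Φ : (Fin (m + 1) → ℝ) → (Fin (m + 1) → ℝ) := fun z =>
    Fin.snoc (Fin.init z) (α (Fin.init z) + β (Fin.init z) * z (Fin.last m)) with hΦ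
  -- continuous linear pieces
  let initL : (Fin (m + 1) → ℝ) →L[ℝ] (Fin m → ℝ) :=
    ContinuousLinearMap.pi fun i => ContinuousLinearMap.proj (Fin.castSucc i)
  let lastL : (Fin (m + 1) → ℝ) →L[ℝ] ℝ := ContinuousLinearMap.proj (Fin.last m)
  have hinitL : ∀ w, initL w = Fin.init w := fun w => rfl
  have hlastL : ∀ w, lastL w = w (Fin.last m) := fun w => rfl
  let row : (Fin (m + 1) → ℝ) → (Fin (m + 1) → ℝ) →L[ℝ] ℝ := fun z =>
    (fderiv ℝ α (Fin.init z)).comp initL +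
      z (Fin.last m) • (fderiv ℝ β (Fin.init z)).comp initL + β (Fin.init z) • lastL
  have hrow : ∀ z w, row z w = fderiv ℝ α (Fin.init z) (Fin.init w) +
      z (Fin.last m) * fderiv ℝ β (Fin.init z) (Fin.init w) + β (Fin.init z) * w (Fin.last m) := by
    intro z w
    simp [row, hinitL, hlastL]
  let Φ' : (Fin (m + 1) → ℝ) → (Fin (m + 1) → ℝ) →L[ℝ] (Fin (m + 1) → ℝ) := fun z =>
    ContinuousLinearMap.pi
      (Fin.lastCases (motive := fun _ => (Fin (m + 1) → ℝ) →L[ℝ] ℝ) (row z)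
        (fun i => ContinuousLinearMap.proj (Fin.castSucc i)))
  have hΦ' : ∀ z w, Φ' z w = Fin.snoc (Fin.init w) (row z w) := by
    intro z w
    funext i
    refine Fin.lastCases ?_ (fun j => ?_) i
    · simp [Φ']
    · simp [Φ', Fin.init]
  -- determinant
  have hdet : ∀ z, (Φ' z).det = β (Fin.init z) := by
    intro z
    have h := LinearMap.det_of_snoc_init (Φ' z : (Fin (m + 1) → ℝ) →ₗ[ℝ] (Fin (m + 1) → ℝ))
      LinearMap.id
      (((fderiv ℝ α (Fin.init z) : (Fin m → ℝ) →L[ℝ] ℝ) +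
        z (Fin.last m) • (fderiv ℝ β (Fin.init z))) : (Fin m → ℝ) →ₗ[ℝ] ℝ)
      (β (Fin.init z)) (fun w => by
        rw [ContinuousLinearMap.coe_coe, hΦ', hrow]
        simp)
    rw [LinearMap.det_id, mul_one] at h
    exact h
  -- derivative
  have hderiv : ∀ z : Fin (m + 1) → ℝ, Fin.init z ∈ G → HasFDerivAt Φ (Φ' z) z := by
    intro z hz
    rw [hasFDerivAt_pi']
    intro i
    refine Fin.lastCases ?_ (fun j => ?_) i
    · have h1 : HasFDerivAt (fun x : Fin (m + 1) → ℝ => Fin.init x) initL z := initL.hasFDerivAt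
      have hαc := (hαd' _ hz).comp z h1
      have hβc := (hβd' _ hz).comp z h1
      have hl : HasFDerivAt (fun x : Fin (m + 1) → ℝ => x (Fin.last m)) lastL z :=
        hasFDerivAt_apply (Fin.last m) z
      have h := hαc.add (hβc.mul hl)
      have hfun : (fun x => Φ x (Fin.last m)) =
          fun x => (α ∘ fun x : Fin (m + 1) → ℝ => Fin.init x) x +
            (β ∘ fun x : Fin (m + 1) → ℝ => Fin.init x) x * x (Fin.last m) := by
        funext x
        simp [hΦ]
      show HasFDerivAt (fun x => Φ x (Fin.last m)) _ z
      rw [hfun]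
      refine h.congr_fderiv (ContinuousLinearMap.ext fun w => ?_)
      simp only [ContinuousLinearMap.coe_comp, Function.comp_apply, hΦ', hrow]
      simp [hinitL, hlastL]
      ring
    · have hfun : (fun x => Φ x (Fin.castSucc j)) = fun x => x (Fin.castSucc j) := by
        funext x
        simp [hΦ, Fin.init]
      show HasFDerivAt (fun x => Φ x (Fin.castSucc j)) _ z
      rw [hfun]
      refine (hasFDerivAt_apply (Fin.castSucc j) z).congr_fderiv
        (ContinuousLinearMap.ext fun w => ?_)
      simp [hΦ', Fin.init]
  -- semialgebraicity of the pieces on the band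
  have hαi : IsSemialgebraicFunOn ℚ r.domain (fun z => α (Fin.init z)) :=
    hα.comp_init_mono r.isSemialgebraic_domain hmemG
  have hβi : IsSemialgebraicFunOn ℚ r.domain (fun z => β (Fin.init z)) :=
    hβ.comp_init_mono r.isSemialgebraic_domain hmemG
  have hli := isSemialgebraicFunOn_apply r.isSemialgebraic_domain (Fin.last _)
  refine changeOfVariablesRel_subset_relations ⟨m + 1, r, r', Φ, Φ', ?_, ?_, ?_, ?_, ?_, rfl⟩
  · -- semialgebraic map
    refine (isSemialgebraicMapOn_iff_forall_holds r.isSemialgebraic_domain).mpr fun i => ?_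
    refine Fin.lastCases ?_ (fun j => ?_) i
    · exact (IsSemialgebraicFunOn.add_holds hαi (IsSemialgebraicFunOn.mul_holds hβi hli)).congr
        fun z _ => by simp [hΦ]
    · exact (isSemialgebraicFunOn_aeval r.isSemialgebraic_domain
        (MvPolynomial.X (Fin.castSucc j))).congr fun z _ => by simp [hΦ, Fin.init]
  · exact fun z hz => (hderiv z (hmemG z hz)).hasFDerivWithinAt
  · intro z₁ hz₁ z₂ hz₂ h
    have hy : Fin.init z₁ = Fin.init z₂ := by
      have := congrArg Fin.init h
      simpa [hΦ] using this
    have hl : α (Fin.init z₁) + β (Fin.init z₁) * z₁ (Fin.last m) =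
        α (Fin.init z₂) + β (Fin.init z₂) * z₂ (Fin.last m) := by
      have := congrFun h (Fin.last m)
      simpa [hΦ] using this
    rw [hy] at hl
    have hs : z₁ (Fin.last m) = z₂ (Fin.last m) :=
      mul_left_cancel₀ (hβpos _ (hmemG z₂ hz₂)).ne' (add_left_cancel hl)
    rw [← Fin.snoc_init_self z₁, ← Fin.snoc_init_self z₂, hy, hs]
  · rw [hr']
    ext w
    simp only [mem_image]
    constructor
    · intro hw
      have hy : Fin.init w ∈ G := hw.1
      have hβy := hβpos _ hy
      refine ⟨Fin.snoc (Fin.init w) ((w (Fin.last m) - α (Fin.init w)) / β (Fin.init w)), ?_, ?_⟩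
      · rw [hr]
        refine ⟨by simpa using hy, ?_, ?_⟩
        · simp only [Fin.init_snoc, Fin.snoc_last]
          rw [le_div_iff₀ hβy]
          have := hw.2.1
          rw [ha' _ hy] at this
          linarith
        · simp only [Fin.init_snoc, Fin.snoc_last]
          rw [div_le_iff₀ hβy]
          have := hw.2.2
          rw [hb' _ hy] at this
          linarith
      · simp only [hΦ, Fin.init_snoc, Fin.snoc_last]
        rw [mul_div_cancel₀ _ hβy.ne', add_sub_cancel, Fin.snoc_init_self]
    · rintro ⟨z, hz, rfl⟩
      have hy : Fin.init z ∈ G := hmemG z hz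
      rw [hr] at hz
      have hβy := hβpos _ hy
      refine ⟨by simpa [hΦ] using hy, ?_, ?_⟩
      · simp only [hΦ, Fin.init_snoc, Fin.snoc_last]
        rw [ha' _ hy]
        have := hz.2.1
        nlinarith
      · simp only [hΦ, Fin.init_snoc, Fin.snoc_last]
        rw [hb' _ hy]
        have := hz.2.2
        nlinarith
  · intro z hz
    rw [hint z hz, hdet, abs_of_pos (hβpos _ (hmemG z hz))]

/-! ### Fibrewise substitution `s = 1 + θ (v - 1)` -/

/-- **Fibrewise substitution.** For `ℚ`-semialgebraic `f`, `v ≥ 1` on a `ℚ`-semialgebraic `D`, the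
unfolded monomial `R₁ = [{(y, s) | y ∈ D, 1 ≤ s ≤ v y}, f(y)/s]` and the box representation
`R₂ = [{(y, θ) | y ∈ D, 0 ≤ θ ≤ 1}, f(y) (v y − 1)/(1 + θ (v y − 1))]` differ by a relation: over the
open semialgebraic set where `v` is smooth and `> 1` (`exists_isOpen_contDiffOn`) this is the affine
substitution `s = 1 + θ (v y − 1)` (`of_sub_of_mem_relations_of_affine`); over the interior of
`{v = 1}` both are junk (a band inside the hyperplane `s = 1`, resp. a zero integrand); the rest of
`D` is null (frontiers and thin semialgebraic sets). No regularity of `v` in `y` is assumed.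
[Kontsevich–Zagier 2001, §1.1–1.2] [folklore] -/
theorem of_sub_of_mem_relations_fibreSubst {m : ℕ} {D : Set (Fin m → ℝ)} {f v : (Fin m → ℝ) → ℝ}
    (hD : IsSemialgebraic ℚ D) (hv : IsSemialgebraicFunOn ℚ D v)
    (hv1 : ∀ y ∈ D, 1 ≤ v y) (R₁ R₂ : IntegralRep (m + 1))
    (h₁d : R₁.domain = KZlog.band D (fun _ => 1) v)
    (h₁i : EqOn R₁.integrand (fun z => f (Fin.init z) / z (Fin.last m)) R₁.domain)
    (h₂d : R₂.domain = KZlog.band D (fun _ => 0) (fun _ => 1))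
    (h₂i : EqOn R₂.integrand (fun z => f (Fin.init z) * (v (Fin.init z) - 1) /
      (1 + z (Fin.last m) * (v (Fin.init z) - 1))) R₂.domain) :
    of R₁ - of R₂ ∈ relations := by
  obtain ⟨G, hGD, hGo, hG, hvG, hDG, hDG0⟩ := exists_isOpen_contDiffOn hD hv
  have hvG' : IsSemialgebraicFunOn ℚ G v := hv.mono hGD hG
  have hcont : ContinuousOn v G := hvG.continuousOn
  have h1v : IsSemialgebraicFunOn ℚ G (fun y => 1 - v y) :=
    (IsSemialgebraicFunOn.sub_holds (isSemialgebraicFunOn_ratCast hG 1) hvG').congr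
      fun y _ => by simp
  -- the pieces of the base
  set Gp : Set (Fin m → ℝ) := {y | y ∈ G ∧ 1 < v y} with hGp
  set G₁ : Set (Fin m → ℝ) := {y | y ∈ G ∧ v y = 1} with hG₁
  set E : Set (Fin m → ℝ) := interior G₁ with hE
  set N : Set (Fin m → ℝ) := D \ (Gp ∪ E) with hN
  have hGp_open : IsOpen Gp := hcont.isOpen_inter_preimage hGo isOpen_Ioi
  have hGp_sa : IsSemialgebraic ℚ Gp := by
    convert h1v.isSemialgebraic_sep_neg using 1
    ext y
    simp only [hGp, mem_setOf_eq, sub_neg]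
  have hG₁_sa : IsSemialgebraic ℚ G₁ := by
    convert h1v.isSemialgebraic_sep_nonneg using 1
    ext y
    simp only [hG₁, mem_setOf_eq, sub_nonneg]
    constructor
    · rintro ⟨hy, h⟩
      exact ⟨hy, h.le⟩
    · rintro ⟨hy, h⟩
      exact ⟨hy, le_antisymm h (hv1 y (hGD hy))⟩
  have hE_sa : IsSemialgebraic ℚ E := Literature.ModelTheory.ExponentialFields.isSemialgebraic_interior hG₁_sa
  have hN_sa : IsSemialgebraic ℚ N := hD.diff (hGp_sa.union hE_sa)
  have hEG₁ : E ⊆ G₁ := interior_subset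
  have hGpD : Gp ⊆ D := fun y hy => hGD hy.1
  have hED : E ⊆ D := fun y hy => hGD (hEG₁ hy).1
  have hN0 : volume N = 0 := by
    have hsub : N ⊆ (D \ G) ∪ frontier G₁ := by
      intro y hy
      by_cases hyG : y ∈ G
      · right
        rcases (hv1 y (hGD hyG)).lt_or_eq with h | h
        · exact absurd (Or.inl ⟨hyG, h⟩) hy.2
        · exact ⟨subset_closure ⟨hyG, h.symm⟩, fun hi => hy.2 (Or.inr hi)⟩
      · exact Or.inl ⟨hy.1, hyG⟩
    exact measure_mono_null hsub
      (measure_union_null hDG0 (volume_frontier_eq_zero_of_isSemialgebraic hG₁_sa))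
  have hDdec : D = Gp ∪ (E ∪ N) := by
    rw [← union_assoc, hN, union_sdiff_cancel (union_subset hGpD hED)]
  have hdisj₁ : Gp ∩ (E ∪ N) = ∅ := by
    ext y
    simp only [mem_inter_iff, mem_union, mem_empty_iff_false, iff_false, not_and]
    rintro hyp (hyE | hyN)
    · exact (ne_of_gt hyp.2) (hEG₁ hyE).2
    · exact hyN.2 (Or.inl hyp)
  have hdisj₂ : E ∩ N = ∅ := by
    ext y
    simp only [mem_inter_iff, mem_empty_iff_false, iff_false, not_and]
    exact fun hyE hyN => hyN.2 (Or.inr hyE)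
  have hEN_sa : IsSemialgebraic ℚ (E ∪ N) := hE_sa.union hN_sa
  -- semialgebraicity of the edges
  have hc1 : IsSemialgebraicFunOn ℚ D (fun _ => (1 : ℝ)) := by
    simpa using isSemialgebraicFunOn_ratCast hD 1
  have hc0 : IsSemialgebraicFunOn ℚ D (fun _ => (0 : ℝ)) := by
    simpa using isSemialgebraicFunOn_ratCast hD 0
  have hc1' : IsSemialgebraicFunOn ℚ (E ∪ N) (fun _ => (1 : ℝ)) := by
    simpa using isSemialgebraicFunOn_ratCast hEN_sa 1
  have hc0' : IsSemialgebraicFunOn ℚ (E ∪ N) (fun _ => (0 : ℝ)) := by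
    simpa using isSemialgebraicFunOn_ratCast hEN_sa 0
  have hvEN : IsSemialgebraicFunOn ℚ (E ∪ N) v := hv.mono (union_subset hED fun y hy => hy.1) hEN_sa
  -- split both representations
  obtain ⟨R₁p, R₁r, h₁pd, h₁pi, h₁rd, h₁ri, hrel₁⟩ :=
    exists_split_band R₁ h₁d hDdec hdisj₁ hGp_sa hEN_sa hc1 hv
  obtain ⟨R₁e, R₁n, h₁ed, -, h₁nd, -, hrel₁'⟩ :=
    exists_split_band R₁r h₁rd rfl hdisj₂ hE_sa hN_sa hc1' hvEN
  obtain ⟨R₂p, R₂r, h₂pd, h₂pi, h₂rd, h₂ri, hrel₂⟩ :=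
    exists_split_band R₂ h₂d hDdec hdisj₁ hGp_sa hEN_sa hc0 hc1
  obtain ⟨R₂e, R₂n, h₂ed, h₂ei, h₂nd, -, hrel₂'⟩ :=
    exists_split_band R₂r h₂rd rfl hdisj₂ hE_sa hN_sa hc0' hc1'
  -- junk
  have hJ₁n : of R₁n ∈ relations :=
    of_mem_relations_of_volume_eq_zero _ (measure_mono_null
      (h₁nd ▸ band_subset_setOf_init_mem) (volume_setOf_init_mem_eq_zero hN0))
  have hJ₂n : of R₂n ∈ relations :=
    of_mem_relations_of_volume_eq_zero _ (measure_mono_null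
      (h₂nd ▸ band_subset_setOf_init_mem) (volume_setOf_init_mem_eq_zero hN0))
  have hJ₁e : of R₁e ∈ relations := by
    refine of_mem_relations_of_volume_eq_zero _ (measure_mono_null (fun z hz => ?_)
      (volume_setOf_last_eq_zero (n := m) 1))
    rw [h₁ed] at hz
    have hv1z : v (Fin.init z) = 1 := (hEG₁ hz.1).2
    exact le_antisymm (hv1z ▸ hz.2.2) hz.2.1
  have hJ₂e : of R₂e ∈ relations := by
    refine of_mem_relations_of_eqOn_zero _ fun z hz => ?_
    have hz' := hz
    rw [h₂ed] at hz'
    have hv1z : v (Fin.init z) = 1 := (hEG₁ hz'.1).2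
    have hzD : z ∈ R₂.domain := h₂d ▸ ⟨hED hz'.1, hz'.2⟩
    rw [h₂ei, h₂ri, h₂i hzD]
    simp [hv1z]
  -- the main piece: affine substitution over `Gp`
  have hmain : of R₂p - of R₁p ∈ relations := by
    have hβ : IsSemialgebraicFunOn ℚ Gp (fun y => v y - 1) :=
      (IsSemialgebraicFunOn.sub_holds (hvG'.mono (fun y hy => hy.1) hGp_sa)
        (isSemialgebraicFunOn_ratCast hGp_sa 1)).congr fun y _ => by simp
    have hβd : DifferentiableOn ℝ (fun y => v y - 1) Gp :=
      ((hvG.differentiableOn (by simp)).mono fun y hy => hy.1).sub_const 1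
    refine of_sub_of_mem_relations_of_affine hGp_open (α := fun _ => 1) (β := fun y => v y - 1)
      (by simpa using isSemialgebraicFunOn_ratCast hGp_sa 1) hβ (differentiableOn_const _) hβd
      (fun y hy => sub_pos.2 hy.2) R₂p R₁p h₂pd h₁pd (fun y _ => by ring) (fun y _ => by ring)
      fun z hz => ?_
    have hz' := hz
    rw [h₂pd] at hz'
    have hy : Fin.init z ∈ D := hGpD hz'.1
    have hθ0 : 0 ≤ z (Fin.last m) := hz'.2.1
    have hθ1 : z (Fin.last m) ≤ 1 := hz'.2.2
    have hc : 0 < v (Fin.init z) - 1 := sub_pos.2 hz'.1.2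
    have hzD : z ∈ R₂.domain := h₂d ▸ ⟨hy, hz'.2⟩
    have hwD : (Fin.snoc (Fin.init z) (1 + (v (Fin.init z) - 1) * z (Fin.last m)) :
        Fin (m + 1) → ℝ) ∈ R₁.domain := by
      rw [h₁d]
      refine ⟨by simpa using hy, ?_, ?_⟩
      · simp only [Fin.snoc_last]
        nlinarith
      · simp only [Fin.init_snoc, Fin.snoc_last]
        nlinarith
    rw [h₂pi, h₂i hzD, h₁pi, h₁i hwD]
    simp only [Fin.init_snoc, Fin.snoc_last]
    have hS : (1 + (v (Fin.init z) - 1) * z (Fin.last m)) ≠ 0 := by nlinarith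
    field_simp
  have : of R₁ - of R₂ = (of R₁ - of R₁p - of R₁r) + (of R₁r - of R₁e - of R₁n) + of R₁e + of R₁n
      - (of R₂p - of R₁p) - ((of R₂ - of R₂p - of R₂r) + (of R₂r - of R₂e - of R₂n) +
        of R₂e + of R₂n) := by abel
  rw [this]
  refine relations.sub_mem (relations.sub_mem (relations.add_mem (relations.add_mem
    (relations.add_mem hrel₁ hrel₁') hJ₁e) hJ₁n) hmain) ?_
  exact relations.add_mem (relations.add_mem (relations.add_mem hrel₂ hrel₂') hJ₂e) hJ₂n

/-! ### The product rule `log (u w) = log u + log w`, unfolded -/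

/-- **The unfolded product rule.** For `ℚ`-semialgebraic `g` and `u, w ≥ 1` on a `ℚ`-semialgebraic
`σ`, `[{1 ≤ t ≤ u w}, g/t] − [{1 ≤ t ≤ u}, g/t] − [{1 ≤ s ≤ w}, g/s]` is a relation: split the first
band at `t = u x` (domain additivity, the graph of `u` being null) and carry `{u ≤ t ≤ u w}` to
`{1 ≤ s ≤ w}` by the substitution `t = u(x) s` over the smooth locus of `u`
(`of_sub_of_mem_relations_of_affine`), the rest of `σ` being null.
[Kontsevich–Zagier 2001, §1.1–1.2] [folklore] -/
theorem of_sub_of_sub_mem_relations_mul {m : ℕ} {σ : Set (Fin m → ℝ)} {g u w : (Fin m → ℝ) → ℝ}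
    (hσ : IsSemialgebraic ℚ σ) (hu : IsSemialgebraicFunOn ℚ σ u)
    (hw : IsSemialgebraicFunOn ℚ σ w) (hu1 : ∀ x ∈ σ, 1 ≤ u x) (hw1 : ∀ x ∈ σ, 1 ≤ w x)
    (R R₁ R₂ : IntegralRep (m + 1))
    (hRd : R.domain = KZlog.band σ (fun _ => 1) (fun x => u x * w x))
    (hRi : EqOn R.integrand (fun z => g (Fin.init z) / z (Fin.last m)) R.domain)
    (hR₁d : R₁.domain = KZlog.band σ (fun _ => 1) u)
    (hR₁i : EqOn R₁.integrand (fun z => g (Fin.init z) / z (Fin.last m)) R₁.domain)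
    (hR₂d : R₂.domain = KZlog.band σ (fun _ => 1) w)
    (hR₂i : EqOn R₂.integrand (fun z => g (Fin.init z) / z (Fin.last m)) R₂.domain) :
    of R - of R₁ - of R₂ ∈ relations := by
  have huw : IsSemialgebraicFunOn ℚ σ (fun x => u x * w x) := IsSemialgebraicFunOn.mul_holds hu hw
  have hc1 : IsSemialgebraicFunOn ℚ σ (fun _ => (1 : ℝ)) := by
    simpa using isSemialgebraicFunOn_ratCast hσ 1
  have hle : ∀ x ∈ σ, u x ≤ u x * w x := fun x hx =>
    le_mul_of_one_le_right (zero_le_one.trans (hu1 x hx)) (hw1 x hx)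
  -- split `R` at `t = u x`
  have hbl : IsSemialgebraic ℚ (KZlog.band σ (fun _ => 1) u) := KZlog.isSemialgebraic_band hc1 hu
  have hbu : IsSemialgebraic ℚ (KZlog.band σ u fun x => u x * w x) :=
    KZlog.isSemialgebraic_band hu huw
  have hsubl : KZlog.band σ (fun _ => 1) u ⊆ R.domain := fun z hz =>
    hRd ▸ ⟨hz.1, hz.2.1, hz.2.2.trans (hle _ hz.1)⟩
  have hsubu : KZlog.band σ u (fun x => u x * w x) ⊆ R.domain := fun z hz =>
    hRd ▸ ⟨hz.1, (hu1 _ hz.1).trans hz.2.1, hz.2.2⟩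
  set Rl := R.restrict _ hbl hsubl with hRl
  set Ru := R.restrict _ hbu hsubu with hRu
  have hsplit : of R - of Rl - of Ru ∈ relations := by
    refine domainAddRel_subset_relations ⟨m + 1, R, Rl, Ru, ?_, ?_, fun _ _ => rfl,
      fun _ _ => rfl, rfl⟩
    · rw [hRd, hRl, hRu, IntegralRep.domain_restrict, IntegralRep.domain_restrict]
      ext z
      simp only [KZlog.band, mem_setOf_eq, mem_union]
      constructor
      · rintro ⟨hx, h1, h2⟩
        rcases le_total (z (Fin.last m)) (u (Fin.init z)) with h | h
        · exact Or.inl ⟨hx, h1, h⟩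
        · exact Or.inr ⟨hx, h, h2⟩
      · rintro (⟨hx, h1, h2⟩ | ⟨hx, h1, h2⟩)
        · exact ⟨hx, h1, h2.trans (hle _ hx)⟩
        · exact ⟨hx, (hu1 _ hx).trans h1, h2⟩
    · refine measure_mono_null (fun z hz => ?_) (volume_graph_eq_zero hu)
      rw [hRl, hRu, IntegralRep.domain_restrict, IntegralRep.domain_restrict] at hz
      exact ⟨hz.1.1, le_antisymm hz.1.2.2 hz.2.2.1⟩
  have hl : of Rl - of R₁ ∈ relations :=
    of_sub_of_mem_relations_of_eqOn (by rw [hR₁d, hRl, IntegralRep.domain_restrict])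
      fun z hz => by
        rw [hRl, IntegralRep.integrand_restrict, hRi (hsubl hz), hR₁i (hR₁d ▸ hz)]
  -- the substitution `t = u s` over the smooth locus of `u`
  obtain ⟨G, hGσ, hGo, hG, huG, hσG, hσG0⟩ := exists_isOpen_contDiffOn hσ hu
  have hdec : σ = G ∪ (σ \ G) := (union_sdiff_cancel hGσ).symm
  have hdisj : G ∩ (σ \ G) = ∅ := inter_sdiff_self G σ
  obtain ⟨RuG, RuN, huGd, huGi, huNd, -, hrelu⟩ :=
    exists_split_band Ru (by rw [hRu, IntegralRep.domain_restrict]) hdec hdisj hG hσG hu huw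
  obtain ⟨R₂G, R₂N, h₂Gd, h₂Gi, h₂Nd, -, hrel₂⟩ :=
    exists_split_band R₂ hR₂d hdec hdisj hG hσG hc1 hw
  have hJu : of RuN ∈ relations :=
    of_mem_relations_of_volume_eq_zero _ (measure_mono_null
      (huNd ▸ band_subset_setOf_init_mem) (volume_setOf_init_mem_eq_zero hσG0))
  have hJ₂ : of R₂N ∈ relations :=
    of_mem_relations_of_volume_eq_zero _ (measure_mono_null
      (h₂Nd ▸ band_subset_setOf_init_mem) (volume_setOf_init_mem_eq_zero hσG0))
  have hmain : of R₂G - of RuG ∈ relations := by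
    refine of_sub_of_mem_relations_of_affine hGo (α := fun _ => 0) (β := u)
      (by simpa using isSemialgebraicFunOn_ratCast hG 0) (hu.mono hGσ hG) (differentiableOn_const _)
      (huG.differentiableOn (by simp)) (fun y hy => one_pos.trans_le (hu1 y (hGσ hy))) R₂G RuG
      h₂Gd huGd (fun y _ => by ring) (fun y _ => by ring) fun z hz => ?_
    have hz' := hz
    rw [h₂Gd] at hz'
    have hx : Fin.init z ∈ σ := hGσ hz'.1
    have hs1 : 1 ≤ z (Fin.last m) := hz'.2.1
    have hsw : z (Fin.last m) ≤ w (Fin.init z) := hz'.2.2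
    have hux := hu1 _ hx
    have hzD : z ∈ R₂.domain := hR₂d ▸ ⟨hx, hz'.2⟩
    have hwD : (Fin.snoc (Fin.init z) (0 + u (Fin.init z) * z (Fin.last m)) : Fin (m + 1) → ℝ) ∈
        R.domain := by
      rw [hRd]
      refine ⟨by simpa using hx, ?_, ?_⟩
      · simp only [Fin.snoc_last]
        nlinarith
      · simp only [Fin.init_snoc, Fin.snoc_last]
        nlinarith
    rw [h₂Gi, hR₂i hzD, huGi, hRu, IntegralRep.integrand_restrict, hRi hwD]
    simp only [Fin.init_snoc, Fin.snoc_last]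
    have h1 : u (Fin.init z) ≠ 0 := by positivity
    have h2 : z (Fin.last m) ≠ 0 := by positivity
    field_simp
    ring
  have : of R - of R₁ - of R₂ = (of R - of Rl - of Ru) + (of Rl - of R₁) + (of Ru - of RuG - of RuN)
      + of RuN - (of R₂G - of RuG) - (of R₂ - of R₂G - of R₂N) - of R₂N := by abel
  rw [this]
  refine relations.sub_mem (relations.sub_mem (relations.sub_mem (relations.add_mem
    (relations.add_mem (relations.add_mem hsplit hl) hrelu) hJu) hmain) hrel₂) hJ₂

/-! ### Lifting a change of variables of the base to the unfolded monomial -/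

/-- **A change of variables of the base lifts to the unfolded monomials**: for Kontsevich–Zagier
change-of-variables data `(Φ, Φ')` on `σ` (rule 2)) and `v = v' ∘ Φ` on `σ`, the map
`Ψ (x, s) = (Φ x, s)` carries `[{x ∈ σ, 1 ≤ s ≤ v x}, f]` to `[{y ∈ Φ σ, 1 ≤ s ≤ v' y}, f']` as an
instance of rule 2) in one more variable (`det Ψ' = det Φ'`, `LinearMap.det_prodMap` after the
identification `ℝⁿ⁺¹ ≃ ℝⁿ × ℝ`; pattern of `KZ.of_mul_mem_relations_of_mem_changeOfVariablesRel`).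
[Kontsevich–Zagier 2001, §1.2, rule 2)] [folklore] -/
theorem of_sub_of_mem_relations_covLift {n : ℕ} {σ : Set (Fin n → ℝ)}
    {Φ : (Fin n → ℝ) → (Fin n → ℝ)} {Φ' : (Fin n → ℝ) → (Fin n → ℝ) →L[ℝ] (Fin n → ℝ)}
    (hΦ : IsSemialgebraicMapOn ℚ σ Φ) (hΦ' : ∀ x ∈ σ, HasFDerivWithinAt Φ (Φ' x) σ x)
    (hinj : InjOn Φ σ) {v v' : (Fin n → ℝ) → ℝ} (hvv' : ∀ x ∈ σ, v x = v' (Φ x))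
    (r r' : IntegralRep (n + 1)) (hr : r.domain = KZlog.band σ (fun _ => 1) v)
    (hr' : r'.domain = KZlog.band (Φ '' σ) (fun _ => 1) v')
    (hint : ∀ z ∈ r.domain, r.integrand z =
      r'.integrand (Fin.snoc (Φ (Fin.init z)) (z (Fin.last n))) * |(Φ' (Fin.init z)).det|) :
    of r - of r' ∈ relations := by
  have hσ : IsSemialgebraic ℚ σ := IsSemialgebraicMapOn.isSemialgebraic_holds hΦ
  have hmem : ∀ z ∈ r.domain, Fin.init z ∈ σ := fun z hz => by
    rw [hr] at hz
    exact hz.1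
  -- the linear identification `ℝⁿ × ℝ ≃ ℝⁿ⁺¹`
  let e : ((Fin n → ℝ) × ℝ) ≃ₗ[ℝ] (Fin (n + 1) → ℝ) :=
    { toFun := fun p => Fin.snoc p.1 p.2
      invFun := fun z => (Fin.init z, z (Fin.last n))
      map_add' := fun p q => by
        ext i; refine Fin.lastCases ?_ (fun j => ?_) i <;> simp
      map_smul' := fun c p => by
        ext i; refine Fin.lastCases ?_ (fun j => ?_) i <;> simp
      left_inv := fun p => by ext <;> simp
      right_inv := fun z => Fin.snoc_init_self z }
  let eL : ((Fin n → ℝ) × ℝ) ≃L[ℝ] (Fin (n + 1) → ℝ) := e.toContinuousLinearEquiv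
  have heL_symm : ∀ z, eL.symm z = (Fin.init z, z (Fin.last n)) := fun z => rfl
  -- the lifted map and its derivative
  let Ψ : (Fin (n + 1) → ℝ) → (Fin (n + 1) → ℝ) := eL ∘ Prod.map Φ id ∘ eL.symm
  let Ψ' : (Fin (n + 1) → ℝ) → (Fin (n + 1) → ℝ) →L[ℝ] (Fin (n + 1) → ℝ) := fun z =>
    (eL : _ →L[ℝ] _).comp ((((Φ' (Fin.init z)).prodMap (ContinuousLinearMap.id ℝ ℝ))).comp
      (eL.symm : _ →L[ℝ] _))
  have hΨ : ∀ z, Ψ z = Fin.snoc (Φ (Fin.init z)) (z (Fin.last n)) := fun z => rfl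
  have hdet : ∀ z, (Ψ' z).det = (Φ' (Fin.init z)).det := by
    intro z
    have hcoe : ((Ψ' z : (Fin (n + 1) → ℝ) →L[ℝ] (Fin (n + 1) → ℝ)) :
        (Fin (n + 1) → ℝ) →ₗ[ℝ] (Fin (n + 1) → ℝ)) =
      (e : ((Fin n → ℝ) × ℝ) →ₗ[ℝ] (Fin (n + 1) → ℝ)) ∘ₗ
        ((((Φ' (Fin.init z) : (Fin n → ℝ) →L[ℝ] (Fin n → ℝ)) : (Fin n → ℝ) →ₗ[ℝ] (Fin n → ℝ)).prodMap
          (LinearMap.id : ℝ →ₗ[ℝ] ℝ)) ∘ₗ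
        (e.symm : (Fin (n + 1) → ℝ) →ₗ[ℝ] ((Fin n → ℝ) × ℝ))) :=
      LinearMap.ext fun v => rfl
    change LinearMap.det _ = LinearMap.det _
    rw [hcoe, LinearMap.det_conj, LinearMap.det_prodMap, LinearMap.det_id, mul_one]
  refine changeOfVariablesRel_subset_relations ⟨n + 1, r, r', Ψ, Ψ', ?_, ?_, ?_, ?_, ?_, rfl⟩
  · refine (isSemialgebraicMapOn_iff_forall_holds r.isSemialgebraic_domain).mpr fun i => ?_
    refine Fin.lastCases ?_ (fun j => ?_) i
    · exact (isSemialgebraicFunOn_apply r.isSemialgebraic_domain (Fin.last _)).congr fun z _ => by simp [hΨ]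
    · have hj : IsSemialgebraicFunOn ℚ σ (fun x => Φ x j) :=
        (isSemialgebraicMapOn_iff_forall_holds hσ).mp hΦ j
      exact (hj.comp_init_mono r.isSemialgebraic_domain hmem).congr fun z _ => by simp [hΨ]
  · intro z hz
    have hx := hmem z hz
    have hg : HasFDerivWithinAt (Prod.map Φ id)
        ((Φ' (Fin.init z)).prodMap (ContinuousLinearMap.id ℝ ℝ)) (σ ×ˢ univ) (eL.symm z) := by
      refine HasFDerivWithinAt.prodMap (eL.symm z) ((hΦ' _ hx).mono ?_) (hasFDerivWithinAt_id _ _)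
      rintro _ ⟨q, hq, rfl⟩
      exact hq.1
    have h2 := (eL.comp_hasFDerivWithinAt_iff).mpr hg
    have h3 := (eL.symm.comp_right_hasFDerivWithinAt_iff (f := eL ∘ Prod.map Φ id)).mpr h2
    exact h3.mono fun w hw => ⟨hmem w hw, mem_univ _⟩
  · intro z₁ hz₁ z₂ hz₂ h
    rw [hΨ, hΨ] at h
    have h1 : Φ (Fin.init z₁) = Φ (Fin.init z₂) := by simpa using congrArg Fin.init h
    have h2 : z₁ (Fin.last n) = z₂ (Fin.last n) := by simpa using congrFun h (Fin.last n)
    rw [← Fin.snoc_init_self z₁, ← Fin.snoc_init_self z₂, hinj (hmem _ hz₁) (hmem _ hz₂) h1, h2]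
  · rw [hr, hr']
    ext w
    simp only [mem_image]
    constructor
    · rintro ⟨⟨x, hx, hxw⟩, h1, h2⟩
      refine ⟨Fin.snoc x (w (Fin.last n)), ⟨by simpa using hx, by simpa using h1, ?_⟩, ?_⟩
      · simpa [hvv' x hx, hxw] using h2
      · rw [hΨ]
        simp only [Fin.init_snoc, Fin.snoc_last, hxw]
        exact Fin.snoc_init_self w
    · rintro ⟨z, hz, rfl⟩
      rw [hΨ]
      refine ⟨?_, ?_, ?_⟩
      · simpa using mem_image_of_mem Φ hz.1
      · simpa using hz.2.1
      · simpa [← hvv' _ hz.1] using hz.2.2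
  · intro z hz
    rw [hint z hz, hdet, hΨ]

/-! ### Measurability and fibre integrals -/

/-- A real semialgebraic function on a measurable set is a.e. strongly measurable for the
restricted Lebesgue measure. [Bochnak–Coste–Roy 1998, §2.2] [folklore] -/
theorem aestronglyMeasurable_of_isSemialgebraicFunOn {N : ℕ} {B : Set (Fin N → ℝ)}
    {W : (Fin N → ℝ) → ℝ} (hW : IsSemialgebraicFunOn ℚ B W) (hB : MeasurableSet B) :
    AEStronglyMeasurable W (volume.restrict B) :=
  (aemeasurable_restrict_of_measurable_subtype hB
    (IsSemialgebraicFunOn.measurable_holds hW)).aestronglyMeasurable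

/-- `∫₀¹ c dθ/(1 + θ c) = log (1 + c)` for `c ≥ 0`. [folklore] -/
theorem integral_div_one_add_mul {c : ℝ} (hc : 0 ≤ c) :
    ∫ θ in (0 : ℝ)..1, c / (1 + θ * c) = Real.log (1 + c) := by
  have hpos : ∀ θ ∈ uIcc (0 : ℝ) 1, 0 < 1 + θ * c := fun θ hθ => by
    rw [uIcc_of_le zero_le_one] at hθ
    nlinarith [hθ.1]
  have hderiv : ∀ θ ∈ uIcc (0 : ℝ) 1,
      HasDerivAt (fun θ => Real.log (1 + θ * c)) (c / (1 + θ * c)) θ := by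
    intro θ hθ
    have h1 : HasDerivAt (fun θ : ℝ => 1 + θ * c) c θ := by
      simpa using ((hasDerivAt_id θ).mul_const c).const_add 1
    convert h1.log (hpos θ hθ).ne' using 1
  have hcont : ContinuousOn (fun θ : ℝ => c / (1 + θ * c)) (Icc 0 1) :=
    continuousOn_const.div (by fun_prop) fun θ hθ => (hpos θ (by rwa [uIcc_of_le zero_le_one])).ne'
  rw [intervalIntegral.integral_eq_sub_of_hasDerivAt hderiv
    (hcont.intervalIntegrable_of_Icc zero_le_one)]
  simp

/-- `∫₀¹ dθ/(1 + θ c)² = 1/(1 + c)` for `c ≥ 0`. [folklore] -/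
theorem integral_inv_one_add_mul_sq {c : ℝ} (hc : 0 ≤ c) :
    ∫ θ in (0 : ℝ)..1, 1 / (1 + θ * c) ^ 2 = 1 / (1 + c) := by
  have hpos : ∀ θ ∈ uIcc (0 : ℝ) 1, 0 < 1 + θ * c := fun θ hθ => by
    rw [uIcc_of_le zero_le_one] at hθ
    nlinarith [hθ.1]
  have hderiv : ∀ θ ∈ uIcc (0 : ℝ) 1,
      HasDerivAt (fun θ => θ / (1 + θ * c)) (1 / (1 + θ * c) ^ 2) θ := by
    intro θ hθ
    have h1 : HasDerivAt (fun θ : ℝ => 1 + θ * c) c θ := by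
      simpa using ((hasDerivAt_id θ).mul_const c).const_add 1
    have h := ((hasDerivAt_id θ).div h1 (hpos θ hθ).ne').congr_deriv
      (show (1 * (1 + θ * c) - id θ * c) / (1 + θ * c) ^ 2 = 1 / (1 + θ * c) ^ 2 by
        simp only [id_eq]; ring)
    exact h
  have hcont : ContinuousOn (fun θ : ℝ => 1 / (1 + θ * c) ^ 2) (Icc 0 1) :=
    continuousOn_const.div (by fun_prop) fun θ hθ =>
      pow_ne_zero 2 (hpos θ (by rwa [uIcc_of_le zero_le_one])).ne'
  rw [intervalIntegral.integral_eq_sub_of_hasDerivAt hderiv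
    (hcont.intervalIntegrable_of_Icc zero_le_one)]
  simp

/-- The exact fibre integral of the box integrand `f c/(1 + θ c)`: `∫₀¹ = f log (1 + c)`
(`c ≥ 0`). [folklore] -/
theorem lintegral_enorm_mul_div_one_add (f c : ℝ) (hc : 0 ≤ c) :
    ∫⁻ θ in Icc (0 : ℝ) 1, ‖f * c / (1 + θ * c)‖ₑ = ‖f * Real.log (1 + c)‖ₑ := by
  have hpos : ∀ θ ∈ Icc (0 : ℝ) 1, 0 < 1 + θ * c := fun θ hθ => by nlinarith [hθ.1]
  have hcont : ContinuousOn (fun θ : ℝ => |f| * c / (1 + θ * c)) (Icc 0 1) :=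
    (continuousOn_const).div (by fun_prop) fun θ hθ => (hpos θ hθ).ne'
  have h1 : EqOn (fun θ : ℝ => ‖f * c / (1 + θ * c)‖ₑ)
      (fun θ => ENNReal.ofReal (|f| * c / (1 + θ * c))) (Icc 0 1) := fun θ hθ => by
    simp only
    rw [← ofReal_norm, norm_div, norm_mul, Real.norm_eq_abs, Real.norm_eq_abs, Real.norm_eq_abs,
      abs_of_nonneg hc, abs_of_pos (hpos θ hθ)]
  rw [setLIntegral_congr_fun measurableSet_Icc h1,
    ← ofReal_integral_eq_lintegral_ofReal (hcont.integrableOn_Icc)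
      ((ae_restrict_mem measurableSet_Icc).mono fun θ hθ =>
        div_nonneg (mul_nonneg (abs_nonneg f) hc) (hpos θ hθ).le),
    integral_Icc_eq_integral_Ioc, ← intervalIntegral.integral_of_le zero_le_one]
  have : ∫ θ in (0 : ℝ)..1, |f| * c / (1 + θ * c) = |f| * Real.log (1 + c) := by
    simp_rw [mul_div_assoc]
    rw [intervalIntegral.integral_const_mul, integral_div_one_add_mul hc]
  rw [this, ← ofReal_norm, norm_mul, Real.norm_eq_abs, Real.norm_eq_abs,
    abs_of_nonneg (Real.log_nonneg (by linarith))]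

/-- The exact fibre integral of the box integrand `f/(1 + θ c)²`: `∫₀¹ = f/(1 + c)` (`c ≥ 0`).
[folklore] -/
theorem lintegral_enorm_div_one_add_sq (f c : ℝ) (hc : 0 ≤ c) :
    ∫⁻ θ in Icc (0 : ℝ) 1, ‖f / (1 + θ * c) ^ 2‖ₑ = ‖f / (1 + c)‖ₑ := by
  have hpos : ∀ θ ∈ Icc (0 : ℝ) 1, 0 < 1 + θ * c := fun θ hθ => by nlinarith [hθ.1]
  have hcont : ContinuousOn (fun θ : ℝ => |f| * (1 / (1 + θ * c) ^ 2)) (Icc 0 1) :=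
    continuousOn_const.mul (continuousOn_const.div (by fun_prop)
      fun θ hθ => pow_ne_zero 2 (hpos θ hθ).ne')
  have h1 : EqOn (fun θ : ℝ => ‖f / (1 + θ * c) ^ 2‖ₑ)
      (fun θ => ENNReal.ofReal (|f| * (1 / (1 + θ * c) ^ 2))) (Icc 0 1) := fun θ hθ => by
    simp only
    rw [← ofReal_norm, norm_div, norm_pow, Real.norm_eq_abs, Real.norm_eq_abs,
      abs_of_pos (hpos θ hθ)]
    ring_nf
  rw [setLIntegral_congr_fun measurableSet_Icc h1,
    ← ofReal_integral_eq_lintegral_ofReal (hcont.integrableOn_Icc)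
      ((ae_restrict_mem measurableSet_Icc).mono fun θ hθ =>
        mul_nonneg (abs_nonneg f) (by positivity)),
    integral_Icc_eq_integral_Ioc, ← intervalIntegral.integral_of_le zero_le_one,
    intervalIntegral.integral_const_mul, integral_inv_one_add_mul_sq hc, ← ofReal_norm, norm_div,
    Real.norm_eq_abs, Real.norm_eq_abs, abs_of_pos (show (0 : ℝ) < 1 + c by linarith),
    mul_one_div]

/-- Semialgebraicity of the box integrand `f(y) c(y)/(1 + θ c(y))` on `{y ∈ S, 0 ≤ θ ≤ 1}`
(`c ≥ 0`). [folklore] -/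
theorem isSemialgebraicFunOn_box₁ {S : Set (Fin m → ℝ)} {f c : (Fin m → ℝ) → ℝ}
    (hS : IsSemialgebraic ℚ S) (hf : IsSemialgebraicFunOn ℚ S f) (hc : IsSemialgebraicFunOn ℚ S c)
    (hc0 : ∀ y ∈ S, 0 ≤ c y) :
    IsSemialgebraicFunOn ℚ (KZlog.band S (fun _ => 0) (fun _ => 1))
      (fun w => f (Fin.init w) * c (Fin.init w) / (1 + w (Fin.last m) * c (Fin.init w))) := by
  have hQ : IsSemialgebraic ℚ (KZlog.band S (fun _ => (0 : ℝ)) (fun _ => 1)) :=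
    KZlog.isSemialgebraic_band (by simpa using isSemialgebraicFunOn_ratCast hS 0)
      (by simpa using isSemialgebraicFunOn_ratCast hS 1)
  have hfi := hf.comp_init_mono hQ band_subset_setOf_init_mem
  have hci := hc.comp_init_mono hQ band_subset_setOf_init_mem
  refine IsSemialgebraicFunOn.div (IsSemialgebraicFunOn.mul_holds hfi hci)
    ((IsSemialgebraicFunOn.add_holds (isSemialgebraicFunOn_ratCast hQ 1)
      (IsSemialgebraicFunOn.mul_holds (isSemialgebraicFunOn_apply hQ (Fin.last _)) hci)).congr
        fun w _ => by simp) fun w hw => ?_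
  have := hc0 _ hw.1
  have := hw.2.1
  positivity

/-- Semialgebraicity of the box integrand `f(y)/(1 + θ c(y))²` on `{y ∈ S, 0 ≤ θ ≤ 1}` (`c ≥ 0`).
[folklore] -/
theorem isSemialgebraicFunOn_box₂ {S : Set (Fin m → ℝ)} {f c : (Fin m → ℝ) → ℝ}
    (hS : IsSemialgebraic ℚ S) (hf : IsSemialgebraicFunOn ℚ S f) (hc : IsSemialgebraicFunOn ℚ S c)
    (hc0 : ∀ y ∈ S, 0 ≤ c y) :
    IsSemialgebraicFunOn ℚ (KZlog.band S (fun _ => 0) (fun _ => 1))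
      (fun w => f (Fin.init w) / (1 + w (Fin.last m) * c (Fin.init w)) ^ 2) := by
  have hQ : IsSemialgebraic ℚ (KZlog.band S (fun _ => (0 : ℝ)) (fun _ => 1)) :=
    KZlog.isSemialgebraic_band (by simpa using isSemialgebraicFunOn_ratCast hS 0)
      (by simpa using isSemialgebraicFunOn_ratCast hS 1)
  have hfi := hf.comp_init_mono hQ band_subset_setOf_init_mem
  have hci := hc.comp_init_mono hQ band_subset_setOf_init_mem
  have hden : IsSemialgebraicFunOn ℚ (KZlog.band S (fun _ => (0 : ℝ)) (fun _ => 1))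
      (fun w => 1 + w (Fin.last m) * c (Fin.init w)) :=
    (IsSemialgebraicFunOn.add_holds (isSemialgebraicFunOn_ratCast hQ 1)
      (IsSemialgebraicFunOn.mul_holds (isSemialgebraicFunOn_apply hQ (Fin.last _)) hci)).congr fun w _ => by simp
  refine (IsSemialgebraicFunOn.div hfi (IsSemialgebraicFunOn.mul_holds hden hden) fun w hw => ?_).congr
    fun w _ => by simp [sq]
  have := hc0 _ hw.1
  have := hw.2.1
  have : (0 : ℝ) < 1 + w (Fin.last m) * c (Fin.init w) := by positivity
  simp only [Pi.mul_apply]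
  positivity

/-- **Integrability of the box integrand `f(y) c(y)/(1 + θ c(y))`** on `{y ∈ S, 0 ≤ θ ≤ 1}` from
that of `f log (1 + c)` on `S` (Tonelli; the fibre integral is exact,
`lintegral_enorm_mul_div_one_add`). [folklore] -/
theorem integrableOn_box₁ {S : Set (Fin m → ℝ)} {f c : (Fin m → ℝ) → ℝ}
    (hS : IsSemialgebraic ℚ S) (hf : IsSemialgebraicFunOn ℚ S f) (hc : IsSemialgebraicFunOn ℚ S c)
    (hc0 : ∀ y ∈ S, 0 ≤ c y) (hint : IntegrableOn (fun y => f y * Real.log (1 + c y)) S) :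
    IntegrableOn (fun w => f (Fin.init w) * c (Fin.init w) / (1 + w (Fin.last m) * c (Fin.init w)))
      (KZlog.band S (fun _ => 0) (fun _ => 1)) := by
  have hQ : IsSemialgebraic ℚ (KZlog.band S (fun _ => (0 : ℝ)) (fun _ => 1)) :=
    KZlog.isSemialgebraic_band (by simpa using isSemialgebraicFunOn_ratCast hS 0)
      (by simpa using isSemialgebraicFunOn_ratCast hS 1)
  have hQm : MeasurableSet (KZlog.band S (fun _ => (0 : ℝ)) (fun _ => 1)) :=
    IsSemialgebraic.measurableSet_holds hQ
  refine KZlog.integrableOn_band_of_lintegral_fibre_le (IsSemialgebraic.measurableSet_holds hS) hQm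
    (fun x t => KZlog.snoc_mem_band)
    (aestronglyMeasurable_of_isSemialgebraicFunOn (isSemialgebraicFunOn_box₁ hS hf hc hc0) hQm)
    (fun y hy => ?_) hint
  have : ∀ t : ℝ, f (Fin.init (Fin.snoc y t : Fin (m + 1) → ℝ)) * c (Fin.init (Fin.snoc y t :
      Fin (m + 1) → ℝ)) / (1 + (Fin.snoc y t : Fin (m + 1) → ℝ) (Fin.last m) *
        c (Fin.init (Fin.snoc y t : Fin (m + 1) → ℝ))) = f y * c y / (1 + t * c y) := fun t => by
    simp
  simp_rw [this]
  exact (lintegral_enorm_mul_div_one_add _ _ (hc0 y hy)).le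

/-- **Integrability of the box integrand `f(y)/(1 + θ c(y))²`** on `{y ∈ S, 0 ≤ θ ≤ 1}` from that
of `f/(1 + c)` on `S` (Tonelli; `lintegral_enorm_div_one_add_sq`). [folklore] -/
theorem integrableOn_box₂ {S : Set (Fin m → ℝ)} {f c : (Fin m → ℝ) → ℝ}
    (hS : IsSemialgebraic ℚ S) (hf : IsSemialgebraicFunOn ℚ S f) (hc : IsSemialgebraicFunOn ℚ S c)
    (hc0 : ∀ y ∈ S, 0 ≤ c y) (hint : IntegrableOn (fun y => f y / (1 + c y)) S) :
    IntegrableOn (fun w => f (Fin.init w) / (1 + w (Fin.last m) * c (Fin.init w)) ^ 2)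
      (KZlog.band S (fun _ => 0) (fun _ => 1)) := by
  have hQ : IsSemialgebraic ℚ (KZlog.band S (fun _ => (0 : ℝ)) (fun _ => 1)) :=
    KZlog.isSemialgebraic_band (by simpa using isSemialgebraicFunOn_ratCast hS 0)
      (by simpa using isSemialgebraicFunOn_ratCast hS 1)
  have hQm : MeasurableSet (KZlog.band S (fun _ => (0 : ℝ)) (fun _ => 1)) :=
    IsSemialgebraic.measurableSet_holds hQ
  refine KZlog.integrableOn_band_of_lintegral_fibre_le (IsSemialgebraic.measurableSet_holds hS) hQm
    (fun x t => KZlog.snoc_mem_band)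
    (aestronglyMeasurable_of_isSemialgebraicFunOn (isSemialgebraicFunOn_box₂ hS hf hc hc0) hQm)
    (fun y hy => ?_) hint
  have : ∀ t : ℝ, f (Fin.init (Fin.snoc y t : Fin (m + 1) → ℝ)) /
      (1 + (Fin.snoc y t : Fin (m + 1) → ℝ) (Fin.last m) *
        c (Fin.init (Fin.snoc y t : Fin (m + 1) → ℝ))) ^ 2 = f y / (1 + t * c y) ^ 2 := fun t => by
    simp
  simp_rw [this]
  exact (lintegral_enorm_div_one_add_sq _ _ (hc0 y hy)).le

/-! ### Finite sums of integrands -/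

/-- Finite sums of real semialgebraic functions are semialgebraic. [Bochnak–Coste–Roy 1998,
Prop. 2.2.6] [folklore] -/
theorem isSemialgebraicFunOn_finset_sum {N : ℕ} {ι : Type*} (s : Finset ι) {σ : Set (Fin N → ℝ)}
    (hσ : IsSemialgebraic ℚ σ) {f : ι → (Fin N → ℝ) → ℝ}
    (h : ∀ i ∈ s, IsSemialgebraicFunOn ℚ σ (f i)) :
    IsSemialgebraicFunOn ℚ σ (fun x => ∑ i ∈ s, f i x) := by
  classical
  induction s using Finset.induction_on with
  | empty => simpa using isSemialgebraicFunOn_ratCast hσ 0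
  | insert a s ha ih =>
    have h' := IsSemialgebraicFunOn.add_holds (h a (Finset.mem_insert_self a s))
      (ih fun i hi => h i (Finset.mem_insert_of_mem hi))
    refine h'.congr fun x _ => ?_
    simp [Finset.sum_insert ha]

/-- **Splitting an integrand into finitely many summands** (iterated integrand additivity): if
`R`, `R₀`, `Rᵢ` have a common domain on which `R.integrand = R₀.integrand + Σᵢ Rᵢ.integrand`, then
`[R] − [R₀] − Σᵢ [Rᵢ]` is a relation. [Kontsevich–Zagier 2001, §1.2, rule 1)] [folklore] -/
theorem of_sub_of_sub_sum_mem_relations {N : ℕ} :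
    ∀ (k : ℕ) (R R₀ : IntegralRep N) (Rs : Fin k → IntegralRep N), R₀.domain = R.domain →
      (∀ i, (Rs i).domain = R.domain) →
      EqOn R.integrand (fun x => R₀.integrand x + ∑ i, (Rs i).integrand x) R.domain →
      of R - of R₀ - ∑ i, of (Rs i) ∈ relations
  | 0, R, R₀, Rs, hd₀, _, h => by
    simp only [Finset.univ_eq_empty, Finset.sum_empty, sub_zero, add_zero] at h ⊢
    exact of_sub_of_mem_relations_of_eqOn hd₀ h
  | k + 1, R, R₀, Rs, hd₀, hd, h => by
    -- the partial representation `[σ, R₀ + Σ_{i < k} Rᵢ]`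
    let R' : IntegralRep N :=
      { domain := R.domain
        integrand := fun x => R₀.integrand x + ∑ i : Fin k, (Rs (Fin.castSucc i)).integrand x
        isSemialgebraic_domain := R.isSemialgebraic_domain
        isSemialgebraicFunOn_integrand :=
          IsSemialgebraicFunOn.add_holds (hd₀ ▸ R₀.isSemialgebraicFunOn_integrand)
            (isSemialgebraicFunOn_finset_sum _ R.isSemialgebraic_domain fun i _ =>
              hd (Fin.castSucc i) ▸ (Rs (Fin.castSucc i)).isSemialgebraicFunOn_integrand)
        integrableOn := (hd₀ ▸ R₀.integrableOn).add (integrable_finsetSum _ fun i _ =>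
          hd (Fin.castSucc i) ▸ (Rs (Fin.castSucc i)).integrableOn) }
    have h1 : of R - of R' - of (Rs (Fin.last k)) ∈ relations :=
      integrandAddRel_subset_relations ⟨N, R, R', Rs (Fin.last k), rfl, hd _, fun x hx => by
        show R.integrand x = R'.integrand x + (Rs (Fin.last k)).integrand x
        rw [h hx]
        simp only [R', Fin.sum_univ_castSucc]
        ring, rfl⟩
    have h2 : of R' - of R₀ - ∑ i : Fin k, of (Rs (Fin.castSucc i)) ∈ relations :=
      of_sub_of_sub_sum_mem_relations k R' R₀ (fun i => Rs (Fin.castSucc i)) hd₀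
        (fun i => hd (Fin.castSucc i)) fun x _ => rfl
    rw [Fin.sum_univ_castSucc]
    have : of R - of R₀ - (∑ i : Fin k, of (Rs (Fin.castSucc i)) + of (Rs (Fin.last k))) =
        (of R - of R' - of (Rs (Fin.last k))) +
          (of R' - of R₀ - ∑ i : Fin k, of (Rs (Fin.castSucc i))) := by abel
    rw [this]
    exact relations.add_mem h1 h2

/-! ### Swapping the last two coordinates -/

/-- The coordinate permutation of `ℝⁿ⁺²` swapping the last two coordinates, read in the first `n`
coordinates. [folklore] -/
theorem init_init_comp_swap (w : Fin (n + 2) → ℝ) :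
    Fin.init (Fin.init (fun i => w (Equiv.swap (Fin.castSucc (Fin.last n)) (Fin.last (n + 1)) i))) =
      Fin.init (Fin.init w) := by
  funext j
  simp only [Fin.init]
  rw [Equiv.swap_apply_of_ne_of_ne]
  · exact ne_of_lt (Fin.castSucc_lt_castSucc_iff.mpr (Fin.castSucc_lt_last j))
  · exact ne_of_lt (Fin.castSucc_lt_last _)

/-- Swapping the last two coordinates: the new second-to-last coordinate. [folklore] -/
theorem init_comp_swap_last (w : Fin (n + 2) → ℝ) :
    Fin.init (fun i => w (Equiv.swap (Fin.castSucc (Fin.last n)) (Fin.last (n + 1)) i))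
      (Fin.last n) = w (Fin.last (n + 1)) := by
  simp [Fin.init]

/-- Swapping the last two coordinates: the new last coordinate. [folklore] -/
theorem comp_swap_last (w : Fin (n + 2) → ℝ) :
    (fun i => w (Equiv.swap (Fin.castSucc (Fin.last n)) (Fin.last (n + 1)) i)) (Fin.last (n + 1)) =
      w (Fin.castSucc (Fin.last n)) := by
  simp

/-- Swapping the last two coordinates, read in the first `n + 1` coordinates. [folklore] -/
theorem init_comp_swap (w : Fin (n + 2) → ℝ) :
    Fin.init (fun i => w (Equiv.swap (Fin.castSucc (Fin.last n)) (Fin.last (n + 1)) i)) =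
      Fin.snoc (Fin.init (Fin.init w)) (w (Fin.last (n + 1))) := by
  rw [← init_init_comp_swap w, ← init_comp_swap_last w, Fin.snoc_init_self]

/-- Semialgebraicity is invariant under relabelling coordinates. [Bochnak–Coste–Roy 1998, §2.2]
[folklore] -/
theorem _root_.Literature.NumberTheory.Transcendental.IsSemialgebraicFunOn.comp_equiv {N k : ℕ}
    {s : Set (Fin N → ℝ)} {f : (Fin N → ℝ) → ℝ} (hf : IsSemialgebraicFunOn ℚ s f)
    (e : Fin N ≃ Fin k) :
    IsSemialgebraicFunOn ℚ {w : Fin k → ℝ | (fun i => w (e i)) ∈ s}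
      (fun w => f (fun i => w (e i))) := by
  rw [isSemialgebraicFunOn_iff]
  let ρ : Fin (N + 1) → Fin (k + 1) := Fin.lastCases (Fin.last k) fun i => Fin.castSucc (e i)
  have hΓ := (isSemialgebraicFunOn_iff.mp hf).preimage_comp ρ
  convert hΓ using 1
  have hinit : ∀ w : Fin (k + 1) → ℝ, Fin.init (w ∘ ρ) = fun i => Fin.init w (e i) := by
    intro w; ext i; simp [Fin.init, ρ]
  have hlast : ∀ w : Fin (k + 1) → ℝ, (w ∘ ρ) (Fin.last N) = w (Fin.last k) := by
    intro w; simp [ρ]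
  ext w
  simp only [mem_setOf_eq, mem_preimage, hinit, hlast]

/-! ### The unfolded logarithmic Stokes formula -/

/-- **Newton–Leibniz along `θ` on the box.** With `c = V − 1 ≥ 0` on `B` and `S = 1 + θ c` on the
box `Q = B × [0, 1]`, `[Q, H V'/S²] − [B, H V'/V]` is one instance of Kontsevich–Zagier's rule 3)
along `θ`, with the `ℚ`-semialgebraic primitive `H V' θ/S` (`∂_θ (θ/S) = 1/S²`,
`[H V' θ/S]₀¹ = H V'/V`). [Kontsevich–Zagier 2001, §1.2, rule 3)] [folklore] -/
theorem of_box₂_sub_of_mem_relations {N : ℕ} {B : Set (Fin N → ℝ)} {H V V' : (Fin N → ℝ) → ℝ}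
    (hB : IsSemialgebraic ℚ B) (hH : IsSemialgebraicFunOn ℚ B H) (hV : IsSemialgebraicFunOn ℚ B V)
    (hV' : IsSemialgebraicFunOn ℚ B V') (hV1 : ∀ z ∈ B, 1 ≤ V z)
    (Rg₂ : IntegralRep (N + 1)) (RB : IntegralRep N)
    (hRg₂d : Rg₂.domain = KZlog.band B (fun _ => 0) (fun _ => 1))
    (hRg₂i : EqOn Rg₂.integrand (fun w => H (Fin.init w) * V' (Fin.init w) /
      (1 + w (Fin.last N) * (V (Fin.init w) - 1)) ^ 2) Rg₂.domain)
    (hRBd : RB.domain = B) (hRBi : EqOn RB.integrand (fun z => H z * V' z / V z) RB.domain) :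
    of Rg₂ - of RB ∈ relations := by
  have hc0 : ∀ z ∈ B, 0 ≤ V z - 1 := fun z hz => sub_nonneg.2 (hV1 z hz)
  have hQsa : IsSemialgebraic ℚ Rg₂.domain := Rg₂.isSemialgebraic_domain
  have hQB : Rg₂.domain ⊆ {w | Fin.init w ∈ B} := hRg₂d ▸ band_subset_setOf_init_mem
  have hc : IsSemialgebraicFunOn ℚ B (fun z => V z - 1) :=
    (IsSemialgebraicFunOn.sub_holds hV (isSemialgebraicFunOn_ratCast hB 1)).congr fun z _ => by simp
  have hci := hc.comp_init_mono hQsa hQB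
  have hHV' : IsSemialgebraicFunOn ℚ B (fun z => H z * V' z) := IsSemialgebraicFunOn.mul_holds hH hV'
  -- the primitive
  have hPsa : IsSemialgebraicFunOn ℚ Rg₂.domain (fun w => H (Fin.init w) * V' (Fin.init w) *
      w (Fin.last N) / (1 + w (Fin.last N) * (V (Fin.init w) - 1))) := by
    refine IsSemialgebraicFunOn.div
      (IsSemialgebraicFunOn.mul_holds (hHV'.comp_init_mono hQsa hQB) (isSemialgebraicFunOn_apply hQsa (Fin.last _)))
      ((IsSemialgebraicFunOn.add_holds (isSemialgebraicFunOn_ratCast hQsa 1)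
        (IsSemialgebraicFunOn.mul_holds (isSemialgebraicFunOn_apply hQsa (Fin.last _)) hci)).congr
          fun w _ => by simp) fun w hw => ?_
    rw [hRg₂d] at hw
    have := hc0 _ hw.1
    have := hw.2.1
    positivity
  refine newtonLeibnizRel_subset_relations ⟨N, Rg₂, RB, fun _ => 0, fun _ => 1, _, hPsa,
    by simpa using isSemialgebraicFunOn_ratCast RB.isSemialgebraic_domain 0,
    by simpa using isSemialgebraicFunOn_ratCast RB.isSemialgebraic_domain 1,
    fun _ _ => zero_le_one, by rw [hRg₂d, hRBd]; rfl, fun z hz => ?_, fun z hz θ hθ => ?_,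
    fun z hz => ?_, rfl⟩
  · rw [hRBd] at hz
    simp only [Fin.init_snoc, Fin.snoc_last]
    exact ContinuousOn.div (by fun_prop) (by fun_prop) fun θ hθ => by nlinarith [hθ.1, hc0 z hz]
  · have hzQ : (Fin.snoc z θ : Fin (N + 1) → ℝ) ∈ Rg₂.domain := by
      rw [hRg₂d]
      rw [hRBd] at hz
      exact KZlog.snoc_mem_band.2 ⟨hz, Ioo_subset_Icc_self hθ⟩
    rw [hRg₂i hzQ]
    rw [hRBd] at hz
    simp only [Fin.init_snoc, Fin.snoc_last]
    have hpos : 0 < 1 + θ * (V z - 1) := by nlinarith [hθ.1, hc0 z hz]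
    have h1 : HasDerivAt (fun θ : ℝ => 1 + θ * (V z - 1)) (V z - 1) θ := by
      simpa using ((hasDerivAt_id θ).mul_const (V z - 1)).const_add 1
    exact (((hasDerivAt_id θ).const_mul (H z * V' z)).div h1 hpos.ne').congr_deriv (by
      simp only [id_eq]
      field_simp
      ring)
  · rw [hRBi hz]
    rw [hRBd] at hz
    simp only [Fin.init_snoc, Fin.snoc_last]
    rw [show (1 : ℝ) + 1 * (V z - 1) = V z by ring]
    simp

/-- The box `B × [0, 1]` over a band `B`, relabelled with `t` last, is the band with the same
edges over `τ × [0, 1]`. [folklore] -/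
theorem setOf_comp_swap_mem_box {n : ℕ} (τ : Set (Fin n → ℝ)) (a b : (Fin n → ℝ) → ℝ) :
    {w : Fin (n + 2) → ℝ | (fun i => w (Equiv.swap (Fin.castSucc (Fin.last n)) (Fin.last (n + 1)) i))
        ∈ KZlog.band (KZlog.band τ a b) (fun _ => 0) (fun _ => 1)} =
      KZlog.band (KZlog.band τ (fun _ => 0) (fun _ => 1)) (fun y => a (Fin.init y))
        (fun y => b (Fin.init y)) := by
  ext w
  simp only [mem_setOf_eq, KZlog.mem_band, init_comp_swap, comp_swap_last, Fin.init_snoc,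
    Fin.snoc_last]
  simp only [Fin.init]
  tauto

/-- **Newton–Leibniz along `t` on the relabelled box.** Over the base `τ × [0, 1]` (coordinates
`(x, θ)`), the band with fibres `[a x, b x]` carrying the integrand
`H' c/S + H V'/S²` (`c = V − 1`, `S = 1 + θ c`, evaluated at `(x, t)`) and the base representation
with integrand `K(x, b x, θ) − K(x, a x, θ)`, `K = H c/S`, differ by one instance of
Kontsevich–Zagier's rule 3) along `t` (the fibrewise regularity of `H`, `V` being that of the
logarithmic move). [Kontsevich–Zagier 2001, §1.2, rule 3)] [folklore] -/
theorem of_swapBox_sub_of_mem_relations {n : ℕ} {τ : Set (Fin n → ℝ)} {a b : (Fin n → ℝ) → ℝ}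
    {H H' V V' : (Fin (n + 1) → ℝ) → ℝ}
    (hτ : IsSemialgebraic ℚ τ) (ha : IsSemialgebraicFunOn ℚ τ a) (hb : IsSemialgebraicFunOn ℚ τ b)
    (hab : ∀ x ∈ τ, a x ≤ b x)
    (hH : IsSemialgebraicFunOn ℚ (KZlog.band τ a b) H)
    (hV : IsSemialgebraicFunOn ℚ (KZlog.band τ a b) V)
    (hV1 : ∀ z ∈ KZlog.band τ a b, 1 ≤ V z)
    (hcont : ∀ x ∈ τ, ContinuousOn (fun t : ℝ => H (Fin.snoc x t)) (Icc (a x) (b x)) ∧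
      ContinuousOn (fun t : ℝ => V (Fin.snoc x t)) (Icc (a x) (b x)))
    (hder : ∀ x ∈ τ, ∀ t ∈ Ioo (a x) (b x),
      HasDerivAt (fun s : ℝ => H (Fin.snoc x s)) (H' (Fin.snoc x t)) t ∧
      HasDerivAt (fun s : ℝ => V (Fin.snoc x s)) (V' (Fin.snoc x t)) t)
    (r : IntegralRep (n + 2)) (Y : IntegralRep (n + 1))
    (hrd : r.domain = KZlog.band (KZlog.band τ (fun _ => 0) (fun _ => 1)) (fun y => a (Fin.init y))
      (fun y => b (Fin.init y)))
    (hri : ∀ (y : Fin (n + 1) → ℝ) (s : ℝ), (Fin.snoc y s : Fin (n + 2) → ℝ) ∈ r.domain →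
      r.integrand (Fin.snoc y s) =
        H' (Fin.snoc (Fin.init y) s) * (V (Fin.snoc (Fin.init y) s) - 1) /
            (1 + y (Fin.last n) * (V (Fin.snoc (Fin.init y) s) - 1)) +
          H (Fin.snoc (Fin.init y) s) * V' (Fin.snoc (Fin.init y) s) /
            (1 + y (Fin.last n) * (V (Fin.snoc (Fin.init y) s) - 1)) ^ 2)
    (hYd : Y.domain = KZlog.band τ (fun _ => 0) (fun _ => 1))
    (hYi : ∀ y ∈ Y.domain, Y.integrand y =
      H (Fin.snoc (Fin.init y) (b (Fin.init y))) * (V (Fin.snoc (Fin.init y) (b (Fin.init y))) - 1) /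
          (1 + y (Fin.last n) * (V (Fin.snoc (Fin.init y) (b (Fin.init y))) - 1)) -
        H (Fin.snoc (Fin.init y) (a (Fin.init y))) * (V (Fin.snoc (Fin.init y) (a (Fin.init y))) - 1) /
          (1 + y (Fin.last n) * (V (Fin.snoc (Fin.init y) (a (Fin.init y))) - 1))) :
    of r - of Y ∈ relations := by
  have hBsa : IsSemialgebraic ℚ (KZlog.band τ a b) := KZlog.isSemialgebraic_band ha hb
  have hmemB : ∀ x ∈ τ, ∀ t ∈ Icc (a x) (b x), (Fin.snoc x t : Fin (n + 1) → ℝ) ∈ KZlog.band τ a b :=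
    fun x hx t ht => KZlog.snoc_mem_band.2 ⟨hx, ht⟩
  have hc : IsSemialgebraicFunOn ℚ (KZlog.band τ a b) (fun z => V z - 1) :=
    (IsSemialgebraicFunOn.sub_holds hV (isSemialgebraicFunOn_ratCast hBsa 1)).congr
      fun z _ => by simp
  have hc0 : ∀ z ∈ KZlog.band τ a b, 0 ≤ V z - 1 := fun z hz => sub_nonneg.2 (hV1 z hz)
  have hτ₁sa : IsSemialgebraic ℚ (KZlog.band τ (fun _ => (0 : ℝ)) (fun _ => 1)) :=
    KZlog.isSemialgebraic_band (by simpa using isSemialgebraicFunOn_ratCast hτ 0)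
      (by simpa using isSemialgebraicFunOn_ratCast hτ 1)
  -- the primitive, in the coordinates `(x, θ, t)`
  have hK'sa : IsSemialgebraicFunOn ℚ r.domain (fun w =>
      H (Fin.snoc (Fin.init (Fin.init w)) (w (Fin.last (n + 1)))) *
        (V (Fin.snoc (Fin.init (Fin.init w)) (w (Fin.last (n + 1)))) - 1) /
        (1 + w (Fin.castSucc (Fin.last n)) *
          (V (Fin.snoc (Fin.init (Fin.init w)) (w (Fin.last (n + 1)))) - 1))) := by
    have h := (isSemialgebraicFunOn_box₁ hBsa hH hc hc0).comp_equiv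
      (Equiv.swap (Fin.castSucc (Fin.last n)) (Fin.last (n + 1)))
    rw [setOf_comp_swap_mem_box] at h
    rw [hrd]
    exact h.congr fun w _ => by simp only [init_comp_swap, comp_swap_last]
  refine newtonLeibnizRel_subset_relations ⟨n + 1, r, Y, fun y => a (Fin.init y),
    fun y => b (Fin.init y), _, hK'sa,
    ha.comp_init_mono Y.isSemialgebraic_domain (hYd ▸ band_subset_setOf_init_mem),
    hb.comp_init_mono Y.isSemialgebraic_domain (hYd ▸ band_subset_setOf_init_mem),
    fun y hy => hab _ (hYd ▸ hy).1, by rw [hrd, hYd]; rfl, fun y hy => ?_, fun y hy s hs => ?_,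
    fun y hy => ?_, rfl⟩
  · -- continuity of `t ↦ K (x, θ, t)` on `[a x, b x]`
    rw [hYd] at hy
    have hx : Fin.init y ∈ τ := hy.1
    simp only [Fin.init_snoc, Fin.snoc_last, Fin.snoc_castSucc]
    have hH1 := (hcont _ hx).1
    have hV1' := (hcont _ hx).2
    refine ContinuousOn.div (hH1.mul (hV1'.sub continuousOn_const))
      (continuousOn_const.add (continuousOn_const.mul (hV1'.sub continuousOn_const)))
      fun s hs => ?_
    have := hc0 _ (hmemB _ hx s hs)
    have := hy.2.1
    positivity
  · -- the derivative of `t ↦ K (x, θ, t)`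
    rw [hYd] at hy
    have hys : (Fin.snoc y s : Fin (n + 2) → ℝ) ∈ r.domain := by
      rw [hrd]
      exact KZlog.snoc_mem_band.2 ⟨hy, Ioo_subset_Icc_self hs⟩
    rw [hri y s hys]
    have hx : Fin.init y ∈ τ := hy.1
    simp only [Fin.init_snoc, Fin.snoc_last, Fin.snoc_castSucc]
    have hsB := hmemB _ hx s (Ioo_subset_Icc_self hs)
    have hpos : 0 < 1 + y (Fin.last n) * (V (Fin.snoc (Fin.init y) s) - 1) := by
      nlinarith [hc0 _ hsB, hy.2.1]
    have hcs : HasDerivAt (fun s : ℝ => V (Fin.snoc (Fin.init y) s) - 1)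
        (V' (Fin.snoc (Fin.init y) s)) s := (hder _ hx s hs).2.sub_const 1
    have hden : HasDerivAt (fun s : ℝ => 1 + y (Fin.last n) * (V (Fin.snoc (Fin.init y) s) - 1))
        (y (Fin.last n) * V' (Fin.snoc (Fin.init y) s)) s := (hcs.const_mul _).const_add 1
    have h := ((hder _ hx s hs).1.mul (hcs.div hden hpos.ne')).congr_deriv (show
      H' (Fin.snoc (Fin.init y) s) *
          ((V (Fin.snoc (Fin.init y) s) - 1) / (1 + y (Fin.last n) * (V (Fin.snoc (Fin.init y) s) - 1))) +
        H (Fin.snoc (Fin.init y) s) *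
          ((V' (Fin.snoc (Fin.init y) s) * (1 + y (Fin.last n) * (V (Fin.snoc (Fin.init y) s) - 1)) -
            (V (Fin.snoc (Fin.init y) s) - 1) * (y (Fin.last n) * V' (Fin.snoc (Fin.init y) s))) /
            (1 + y (Fin.last n) * (V (Fin.snoc (Fin.init y) s) - 1)) ^ 2) =
      H' (Fin.snoc (Fin.init y) s) * (V (Fin.snoc (Fin.init y) s) - 1) /
          (1 + y (Fin.last n) * (V (Fin.snoc (Fin.init y) s) - 1)) +
        H (Fin.snoc (Fin.init y) s) * V' (Fin.snoc (Fin.init y) s) /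
          (1 + y (Fin.last n) * (V (Fin.snoc (Fin.init y) s) - 1)) ^ 2 by
      field_simp
      ring)
    refine HasDerivAt.congr_of_eventuallyEq h (Eventually.of_forall fun s => ?_)
    simp only [Pi.mul_apply, Pi.div_apply]
    ring
  · rw [hYi y hy]
    simp only [Fin.init_snoc, Fin.snoc_last, Fin.snoc_castSucc]

/-- **The unfolded logarithmic Stokes formula** (route KontsevichZagierPeriods/LiouvilleUnfolding,
crux UnfoldedLogStokes, in the form needed for `KZlog.Conservative`). Data: a band
`B = {(x, t) | x ∈ τ, a x ≤ t ≤ b x}` with `ℚ`-semialgebraic `a ≤ b` on `τ`; `H, H', V, V'`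
`ℚ`-semialgebraic on `B`, `V ≥ 1`, `H (x, ·)`, `V (x, ·)` continuous on the closed fibres and
differentiable with derivatives `H', V'` on the open fibres; `H V'/V` and `H' log V` integrable on
`B`, the boundary monomials `H(·, b) log V(·, b)`, `H(·, a) log V(·, a)` integrable on `τ`. Then for
the four honest representations `RB = [B, H V'/V]`, `W = [{(x,t,s) | (x,t) ∈ B, 1 ≤ s ≤ V}, H'/s]`,
`Ub = [{(x,s) | 1 ≤ s ≤ V(x, b x)}, H(x, b x)/s]`, `Ua = [{(x,s) | 1 ≤ s ≤ V(x, a x)}, −H(x, a x)/s]`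
(the unfoldings of `∫_B H V'/V`, `∫_B H' log V`, `∫_τ H(·,b) log V(·,b)`, `−∫_τ H(·,a) log V(·,a)`),
`[RB] + [W] − [Ub] − [Ua]` is a KZ relation. Proof: with `c = V − 1`, `S = 1 + θ c` on the box
`Q = B × [0, 1]`: `[W] ∼ [Q, H' c/S]` (fibrewise substitution), `[Q, H V'/S²] − [RB]` is a
Newton–Leibniz move along `θ` (`of_box₂_sub_of_mem_relations`), `[Q, H' c/S + H V'/S²]`
relabelled with `t` last is a Newton–Leibniz band over `τ × [0,1]` with primitive `K = H c/S`
(`of_swapBox_sub_of_mem_relations`), and the two halves of its base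
`[τ × [0,1], K(x,b x,θ) − K(x,a x,θ)]` are `Ub`, `Ua` by fibrewise substitution.
[Kontsevich–Zagier 2001, §1.1–1.2] [folklore] -/
theorem unfoldedLogStokes_mem_relations {n : ℕ} {τ : Set (Fin n → ℝ)} {a b : (Fin n → ℝ) → ℝ}
    {H H' V V' : (Fin (n + 1) → ℝ) → ℝ}
    (hτ : IsSemialgebraic ℚ τ) (ha : IsSemialgebraicFunOn ℚ τ a) (hb : IsSemialgebraicFunOn ℚ τ b)
    (hab : ∀ x ∈ τ, a x ≤ b x)
    (hH : IsSemialgebraicFunOn ℚ (KZlog.band τ a b) H)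
    (hH' : IsSemialgebraicFunOn ℚ (KZlog.band τ a b) H')
    (hV : IsSemialgebraicFunOn ℚ (KZlog.band τ a b) V)
    (hV' : IsSemialgebraicFunOn ℚ (KZlog.band τ a b) V')
    (hV1 : ∀ z ∈ KZlog.band τ a b, 1 ≤ V z)
    (hcont : ∀ x ∈ τ, ContinuousOn (fun t : ℝ => H (Fin.snoc x t)) (Icc (a x) (b x)) ∧
      ContinuousOn (fun t : ℝ => V (Fin.snoc x t)) (Icc (a x) (b x)))
    (hder : ∀ x ∈ τ, ∀ t ∈ Ioo (a x) (b x),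
      HasDerivAt (fun s : ℝ => H (Fin.snoc x s)) (H' (Fin.snoc x t)) t ∧
      HasDerivAt (fun s : ℝ => V (Fin.snoc x s)) (V' (Fin.snoc x t)) t)
    (hintHV : IntegrableOn (fun z => H z * V' z / V z) (KZlog.band τ a b))
    (hintH' : IntegrableOn (fun z => H' z * Real.log (V z)) (KZlog.band τ a b))
    (hHb : IsSemialgebraicFunOn ℚ τ fun x => H (Fin.snoc x (b x)))
    (hVb : IsSemialgebraicFunOn ℚ τ fun x => V (Fin.snoc x (b x)))
    (hHa : IsSemialgebraicFunOn ℚ τ fun x => H (Fin.snoc x (a x)))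
    (hVa : IsSemialgebraicFunOn ℚ τ fun x => V (Fin.snoc x (a x)))
    (hintb : IntegrableOn (fun x => H (Fin.snoc x (b x)) * Real.log (V (Fin.snoc x (b x)))) τ)
    (hinta : IntegrableOn (fun x => H (Fin.snoc x (a x)) * Real.log (V (Fin.snoc x (a x)))) τ)
    (RB : IntegralRep (n + 1)) (W : IntegralRep (n + 2)) (Ub Ua : IntegralRep (n + 1))
    (hRBd : RB.domain = KZlog.band τ a b)
    (hRBi : EqOn RB.integrand (fun z => H z * V' z / V z) RB.domain)
    (hWd : W.domain = KZlog.band (KZlog.band τ a b) (fun _ => 1) V)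
    (hWi : EqOn W.integrand (fun w => H' (Fin.init w) / w (Fin.last (n + 1))) W.domain)
    (hUbd : Ub.domain = KZlog.band τ (fun _ => 1) fun x => V (Fin.snoc x (b x)))
    (hUbi : EqOn Ub.integrand
      (fun z => H (Fin.snoc (Fin.init z) (b (Fin.init z))) / z (Fin.last n)) Ub.domain)
    (hUad : Ua.domain = KZlog.band τ (fun _ => 1) fun x => V (Fin.snoc x (a x)))
    (hUai : EqOn Ua.integrand
      (fun z => -H (Fin.snoc (Fin.init z) (a (Fin.init z))) / z (Fin.last n)) Ua.domain) :
    of RB + of W - of Ub - of Ua ∈ relations := by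
  have hBsa : IsSemialgebraic ℚ (KZlog.band τ a b) := KZlog.isSemialgebraic_band ha hb
  have hBm : MeasurableSet (KZlog.band τ a b) := IsSemialgebraic.measurableSet_holds hBsa
  have hmemB : ∀ x ∈ τ, ∀ t ∈ Icc (a x) (b x), (Fin.snoc x t : Fin (n + 1) → ℝ) ∈ KZlog.band τ a b :=
    fun x hx t ht => KZlog.snoc_mem_band.2 ⟨hx, ht⟩
  have hc : IsSemialgebraicFunOn ℚ (KZlog.band τ a b) (fun z => V z - 1) :=
    (IsSemialgebraicFunOn.sub_holds hV (isSemialgebraicFunOn_ratCast hBsa 1)).congr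
      fun z _ => by simp
  have hc0 : ∀ z ∈ KZlog.band τ a b, 0 ≤ V z - 1 := fun z hz => sub_nonneg.2 (hV1 z hz)
  have hHV' : IsSemialgebraicFunOn ℚ (KZlog.band τ a b) (fun z => H z * V' z) :=
    IsSemialgebraicFunOn.mul_holds hH hV'
  -- the box `Q = B × [0, 1]` and its two integrands `g₁ = H' c/S`, `g₂ = H V'/S²`
  have hQsa : IsSemialgebraic ℚ (KZlog.band (KZlog.band τ a b) (fun _ => (0 : ℝ)) (fun _ => 1)) :=
    KZlog.isSemialgebraic_band (by simpa using isSemialgebraicFunOn_ratCast hBsa 0)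
      (by simpa using isSemialgebraicFunOn_ratCast hBsa 1)
  have hg₁sa := isSemialgebraicFunOn_box₁ hBsa hH' hc hc0
  have hg₂sa := isSemialgebraicFunOn_box₂ hBsa hHV' hc hc0
  have hg₁int := integrableOn_box₁ hBsa hH' hc hc0 (hintH'.congr_fun (fun z _ => by
    show H' z * Real.log (V z) = H' z * Real.log (1 + (V z - 1))
    rw [add_sub_cancel]) hBm)
  have hg₂int := integrableOn_box₂ hBsa hHV' hc hc0 (hintHV.congr_fun (fun z _ => by
    show H z * V' z / V z = H z * V' z / (1 + (V z - 1))
    rw [add_sub_cancel]) hBm)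
  let Rg₁ : IntegralRep (n + 2) := ⟨_, _, hQsa, hg₁sa, hg₁int⟩
  let Rg₂ : IntegralRep (n + 2) := ⟨_, _, hQsa, hg₂sa, hg₂int⟩
  let RQ : IntegralRep (n + 2) := ⟨_, _, hQsa,
    (IsSemialgebraicFunOn.add_holds hg₁sa hg₂sa).congr (fun w _ => rfl), hg₁int.add hg₂int⟩
  -- (S2) the monomial `W` is the box representation `[Q, g₁]`
  have h2 : of W - of Rg₁ ∈ relations :=
    of_sub_of_mem_relations_fibreSubst hBsa hV hV1 W Rg₁ hWd hWi rfl fun w _ => rfl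
  -- (S3) `[Q, g₂] − [RB]` is a Newton–Leibniz move along `θ`
  have h3 : of Rg₂ - of RB ∈ relations :=
    of_box₂_sub_of_mem_relations hBsa hH hV hV' hV1 Rg₂ RB rfl (fun w _ => rfl) hRBd hRBi
  -- (S1) `[Q, g₁ + g₂] = [Q, g₁] + [Q, g₂]`
  have h1 : of RQ - of Rg₁ - of Rg₂ ∈ relations :=
    integrandAddRel_subset_relations ⟨n + 2, RQ, Rg₁, Rg₂, rfl, rfl, fun _ _ => rfl, rfl⟩
  -- (S0) relabel the box with `t` last
  have h0 : of RQ - of (RQ.reindex (Equiv.swap (Fin.castSucc (Fin.last n)) (Fin.last (n + 1)))) ∈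
      relations := of_sub_of_reindex_mem_relations RQ _
  have hQ'eq : (RQ.reindex (Equiv.swap (Fin.castSucc (Fin.last n)) (Fin.last (n + 1)))).domain =
      KZlog.band (KZlog.band τ (fun _ => 0) (fun _ => 1)) (fun y => a (Fin.init y))
        (fun y => b (Fin.init y)) := setOf_comp_swap_mem_box τ a b
  -- the boundary integrands `K(x, b x, θ)`, `K(x, a x, θ)` over `τ × [0, 1]`
  have hτ₁sa : IsSemialgebraic ℚ (KZlog.band τ (fun _ => (0 : ℝ)) (fun _ => 1)) :=
    KZlog.isSemialgebraic_band (by simpa using isSemialgebraicFunOn_ratCast hτ 0)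
      (by simpa using isSemialgebraicFunOn_ratCast hτ 1)
  have hτm : MeasurableSet τ := IsSemialgebraic.measurableSet_holds hτ
  have hcbsa : IsSemialgebraicFunOn ℚ τ (fun x => V (Fin.snoc x (b x)) - 1) :=
    (IsSemialgebraicFunOn.sub_holds hVb (isSemialgebraicFunOn_ratCast hτ 1)).congr fun x _ => by
      simp
  have hcasa : IsSemialgebraicFunOn ℚ τ (fun x => V (Fin.snoc x (a x)) - 1) :=
    (IsSemialgebraicFunOn.sub_holds hVa (isSemialgebraicFunOn_ratCast hτ 1)).congr fun x _ => by
      simp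
  have hVb1 : ∀ x ∈ τ, 1 ≤ V (Fin.snoc x (b x)) := fun x hx =>
    hV1 _ (hmemB x hx _ ⟨hab x hx, le_rfl⟩)
  have hVa1 : ∀ x ∈ τ, 1 ≤ V (Fin.snoc x (a x)) := fun x hx =>
    hV1 _ (hmemB x hx _ ⟨le_rfl, hab x hx⟩)
  have hcb0 : ∀ x ∈ τ, 0 ≤ V (Fin.snoc x (b x)) - 1 := fun x hx => sub_nonneg.2 (hVb1 x hx)
  have hca0 : ∀ x ∈ τ, 0 ≤ V (Fin.snoc x (a x)) - 1 := fun x hx => sub_nonneg.2 (hVa1 x hx)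
  have hKbsa := isSemialgebraicFunOn_box₁ hτ hHb hcbsa hcb0
  have hKasa := isSemialgebraicFunOn_box₁ hτ hHa hcasa hca0
  have hKbint := integrableOn_box₁ hτ hHb hcbsa hcb0 (hintb.congr_fun (fun x _ => by
    show _ = H (Fin.snoc x (b x)) * Real.log (1 + (V (Fin.snoc x (b x)) - 1))
    rw [add_sub_cancel]) hτm)
  have hKaint := integrableOn_box₁ hτ hHa hcasa hca0 (hinta.congr_fun (fun x _ => by
    show _ = H (Fin.snoc x (a x)) * Real.log (1 + (V (Fin.snoc x (a x)) - 1))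
    rw [add_sub_cancel]) hτm)
  let Yb : IntegralRep (n + 1) := ⟨_, _, hτ₁sa, hKbsa, hKbint⟩
  let Yam : IntegralRep (n + 1) := ⟨_, _, hτ₁sa, hKasa.neg, hKaint.neg⟩
  let Y : IntegralRep (n + 1) := ⟨_, fun y => Yb.integrand y + Yam.integrand y, hτ₁sa,
    (IsSemialgebraicFunOn.add_holds hKbsa hKasa.neg).congr (fun y _ => rfl),
    hKbint.add hKaint.neg⟩
  -- (S4) Newton–Leibniz along `t`
  let rNL : IntegralRep (n + 2) := ⟨_, _, hQ'eq ▸ (RQ.reindex _).isSemialgebraic_domain,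
    hQ'eq ▸ (RQ.reindex _).isSemialgebraicFunOn_integrand, hQ'eq ▸ (RQ.reindex _).integrableOn⟩
  have hext : RQ.reindex (Equiv.swap (Fin.castSucc (Fin.last n)) (Fin.last (n + 1))) = rNL :=
    IntegralRep.ext' hQ'eq rfl
  have h4 : of rNL - of Y ∈ relations := by
    refine of_swapBox_sub_of_mem_relations hτ ha hb hab hH hV hV1 hcont hder rNL Y rfl
      (fun y s _ => ?_) rfl (fun y _ => ?_)
    · show H' (Fin.init fun i => (Fin.snoc y s : Fin (n + 2) → ℝ)
          (Equiv.swap (Fin.castSucc (Fin.last n)) (Fin.last (n + 1)) i)) *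
          (V (Fin.init fun i => (Fin.snoc y s : Fin (n + 2) → ℝ)
            (Equiv.swap (Fin.castSucc (Fin.last n)) (Fin.last (n + 1)) i)) - 1) /
          (1 + (fun i => (Fin.snoc y s : Fin (n + 2) → ℝ)
            (Equiv.swap (Fin.castSucc (Fin.last n)) (Fin.last (n + 1)) i)) (Fin.last (n + 1)) *
            (V (Fin.init fun i => (Fin.snoc y s : Fin (n + 2) → ℝ)
              (Equiv.swap (Fin.castSucc (Fin.last n)) (Fin.last (n + 1)) i)) - 1)) +
        H (Fin.init fun i => (Fin.snoc y s : Fin (n + 2) → ℝ)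
          (Equiv.swap (Fin.castSucc (Fin.last n)) (Fin.last (n + 1)) i)) *
          V' (Fin.init fun i => (Fin.snoc y s : Fin (n + 2) → ℝ)
            (Equiv.swap (Fin.castSucc (Fin.last n)) (Fin.last (n + 1)) i)) /
          (1 + (fun i => (Fin.snoc y s : Fin (n + 2) → ℝ)
            (Equiv.swap (Fin.castSucc (Fin.last n)) (Fin.last (n + 1)) i)) (Fin.last (n + 1)) *
            (V (Fin.init fun i => (Fin.snoc y s : Fin (n + 2) → ℝ)
              (Equiv.swap (Fin.castSucc (Fin.last n)) (Fin.last (n + 1)) i)) - 1)) ^ 2 = _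
      simp only [init_comp_swap, comp_swap_last, Fin.init_snoc, Fin.snoc_last, Fin.snoc_castSucc]
    · show _ + -_ = _
      exact (sub_eq_add_neg _ _).symm
  -- (S5) `[Y] = [Yb] + [Yam]`
  have h5 : of Y - of Yb - of Yam ∈ relations :=
    integrandAddRel_subset_relations ⟨n + 1, Y, Yb, Yam, rfl, rfl, fun y _ => rfl, rfl⟩
  -- (S6) the boundary monomials, by fibrewise substitution
  have h6b : of Ub - of Yb ∈ relations :=
    of_sub_of_mem_relations_fibreSubst hτ (f := fun x => H (Fin.snoc x (b x))) hVb hVb1 Ub Yb hUbd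
      hUbi rfl fun z _ => rfl
  have h6a : of Ua - of Yam ∈ relations :=
    of_sub_of_mem_relations_fibreSubst hτ (f := fun x => -H (Fin.snoc x (a x))) hVa hVa1 Ua Yam
      hUad hUai rfl fun z _ => by
        show -( _ ) = _
        simp only [neg_mul, neg_div]
  -- assembly
  have key : of RB + of W - of Ub - of Ua =
      (of W - of Rg₁) - (of Rg₂ - of RB) - (of RQ - of Rg₁ - of Rg₂) +
        (of RQ - of (RQ.reindex (Equiv.swap (Fin.castSucc (Fin.last n)) (Fin.last (n + 1))))) +
        (of rNL - of Y) + (of Y - of Yb - of Yam) - (of Ub - of Yb) - (of Ua - of Yam) := by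
    rw [hext]
    abel
  rw [key]
  exact relations.sub_mem (relations.sub_mem (relations.add_mem (relations.add_mem
    (relations.add_mem (relations.sub_mem (relations.sub_mem h2 h3) h1) h0) h4) h5) h6b) h6a

end KZ

/-! ### The nine logarithmic moves unfold into KZ relations -/

namespace KZlog

variable {n : ℕ}

/-- The domain of an unfolded monomial of an explicit term. [folklore] -/
theorem monomialRep_domain_mk {σ : Set (Fin n → ℝ)} {h₀ : (Fin n → ℝ) → ℝ} {k : ℕ}
    {h v : Fin k → (Fin n → ℝ) → ℝ} (hadm : Term.Admissible ⟨σ, h₀, k, h, v⟩) (i : Fin k) :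
    (IntegralRep.monomialRep ⟨⟨σ, h₀, k, h, v⟩, hadm⟩ i).domain = band σ (fun _ => 1) (v i) := rfl

/-- The integrand of an unfolded monomial of an explicit term. [folklore] -/
theorem monomialRep_integrand_mk {σ : Set (Fin n → ℝ)} {h₀ : (Fin n → ℝ) → ℝ} {k : ℕ}
    {h v : Fin k → (Fin n → ℝ) → ℝ} (hadm : Term.Admissible ⟨σ, h₀, k, h, v⟩) (i : Fin k) :
    (IntegralRep.monomialRep ⟨⟨σ, h₀, k, h, v⟩, hadm⟩ i).integrand =
      fun z => h i (Fin.init z) / z (Fin.last n) := rfl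

/-- Bands only depend on the values of the edges on the base. [folklore] -/
theorem band_congr {s : Set (Fin n → ℝ)} {a b b' : (Fin n → ℝ) → ℝ} (h : EqOn b b' s) :
    band s a b = band s a b' := by
  ext z
  simp only [band, mem_setOf_eq]
  constructor
  · rintro ⟨hz, h1, h2⟩
    exact ⟨hz, h1, h hz ▸ h2⟩
  · rintro ⟨hz, h1, h2⟩
    exact ⟨hz, h1, (h hz).symm ▸ h2⟩

/-- **Move (1a) unfolds into KZ relations**: domain additivity for the rational part and for each
unfolded monomial (the bands over `σ₁`, `σ₂` overlap in a cylinder over the null set `σ₁ ∩ σ₂`).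
[Kontsevich–Zagier 2001, §1.2, rule 1)] [folklore] -/
theorem unfold_mem_of_mem_domainAddRel {c : FormalRep} (hc : c ∈ domainAddRel) :
    unfold c ∈ KZ.relations := by
  obtain ⟨n, k, σ₁, σ₂, h₀, h, v, ⟨T, hadm⟩, ⟨T₁, hadm₁⟩, ⟨T₂, hadm₂⟩, hr, hr₁, hr₂, hvol, rfl⟩ := hc
  obtain rfl : T = _ := hr
  obtain rfl : T₁ = _ := hr₁
  obtain rfl : T₂ = _ := hr₂
  simp only [map_sub, unfold_of]
  have hrat : KZ.of (IntegralRep.ratPart ⟨_, hadm⟩) - KZ.of (IntegralRep.ratPart ⟨_, hadm₁⟩) -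
      KZ.of (IntegralRep.ratPart ⟨_, hadm₂⟩) ∈ KZ.relations :=
    KZ.domainAddRel_subset_relations ⟨n, IntegralRep.ratPart ⟨_, hadm⟩, IntegralRep.ratPart ⟨_, hadm₁⟩,
      IntegralRep.ratPart ⟨_, hadm₂⟩, rfl, hvol, fun _ _ => rfl, fun _ _ => rfl, rfl⟩
  have hmono : ∀ i : Fin k, KZ.of (IntegralRep.monomialRep ⟨_, hadm⟩ i) -
      KZ.of (IntegralRep.monomialRep ⟨_, hadm₁⟩ i) - KZ.of (IntegralRep.monomialRep ⟨_, hadm₂⟩ i) ∈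
        KZ.relations := fun i =>
    KZ.domainAddRel_subset_relations ⟨n + 1, IntegralRep.monomialRep ⟨_, hadm⟩ i,
      IntegralRep.monomialRep ⟨_, hadm₁⟩ i, IntegralRep.monomialRep ⟨_, hadm₂⟩ i,
      by simp only [monomialRep_domain_mk]; exact KZ.band_union,
      measure_mono_null (fun z (hz : z ∈ band σ₁ (fun _ => 1) (v i) ∩ band σ₂ (fun _ => 1) (v i)) =>
        show Fin.init z ∈ σ₁ ∩ σ₂ from ⟨hz.1.1, hz.2.1⟩) (KZ.volume_setOf_init_mem_eq_zero hvol),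
      fun _ _ => rfl, fun _ _ => rfl, rfl⟩
  have : KZ.of (IntegralRep.ratPart ⟨_, hadm⟩) + ∑ i, KZ.of (IntegralRep.monomialRep ⟨_, hadm⟩ i) -
      (KZ.of (IntegralRep.ratPart ⟨_, hadm₁⟩) + ∑ i, KZ.of (IntegralRep.monomialRep ⟨_, hadm₁⟩ i)) -
      (KZ.of (IntegralRep.ratPart ⟨_, hadm₂⟩) + ∑ i, KZ.of (IntegralRep.monomialRep ⟨_, hadm₂⟩ i)) =
      (KZ.of (IntegralRep.ratPart ⟨_, hadm⟩) - KZ.of (IntegralRep.ratPart ⟨_, hadm₁⟩) -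
        KZ.of (IntegralRep.ratPart ⟨_, hadm₂⟩)) +
      ∑ i : Fin k, (KZ.of (IntegralRep.monomialRep ⟨_, hadm⟩ i) -
        KZ.of (IntegralRep.monomialRep ⟨_, hadm₁⟩ i) - KZ.of (IntegralRep.monomialRep ⟨_, hadm₂⟩ i)) := by
    simp only [Finset.sum_sub_distrib]
    abel
  rw [this]
  exact KZ.relations.add_mem hrat (sum_mem fun i _ => hmono i)

/-- **Move (1b) unfolds into KZ relations**: integrand additivity for the rational parts; the
unfolded monomials of the concatenated family are literally those of the two families.
[Kontsevich–Zagier 2001, §1.2, rule 1)] [folklore] -/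
theorem unfold_mem_of_mem_termAddRel {c : FormalRep} (hc : c ∈ termAddRel) :
    unfold c ∈ KZ.relations := by
  obtain ⟨n, k, k', σ, h₀, h₀', h, v, h', v', ⟨T, hadm⟩, ⟨T₁, hadm₁⟩, ⟨T₂, hadm₂⟩, hr, hr₁, hr₂, rfl⟩ :=
    hc
  obtain rfl : T = _ := hr
  obtain rfl : T₁ = _ := hr₁
  obtain rfl : T₂ = _ := hr₂
  simp only [map_sub, unfold_of]
  have hrat : KZ.of (IntegralRep.ratPart ⟨_, hadm⟩) - KZ.of (IntegralRep.ratPart ⟨_, hadm₁⟩) -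
      KZ.of (IntegralRep.ratPart ⟨_, hadm₂⟩) ∈ KZ.relations :=
    KZ.integrandAddRel_subset_relations ⟨n, IntegralRep.ratPart ⟨_, hadm⟩, IntegralRep.ratPart ⟨_, hadm₁⟩,
      IntegralRep.ratPart ⟨_, hadm₂⟩, rfl, rfl, fun _ _ => rfl, rfl⟩
  have hl : ∀ i : Fin k, IntegralRep.monomialRep ⟨_, hadm⟩ (Fin.castAdd k' i) =
      IntegralRep.monomialRep ⟨_, hadm₁⟩ i := fun i =>
    KZ.IntegralRep.ext' (by simp only [monomialRep_domain_mk, Fin.append_left])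
      (by simp only [monomialRep_integrand_mk, Fin.append_left])
  have hr' : ∀ j : Fin k', IntegralRep.monomialRep ⟨_, hadm⟩ (Fin.natAdd k j) =
      IntegralRep.monomialRep ⟨_, hadm₂⟩ j := fun j =>
    KZ.IntegralRep.ext' (by simp only [monomialRep_domain_mk, Fin.append_right])
      (by simp only [monomialRep_integrand_mk, Fin.append_right])
  rw [Fin.sum_univ_add]
  simp only [hl, hr']
  have : KZ.of (IntegralRep.ratPart ⟨_, hadm⟩) +
      (∑ i, KZ.of (IntegralRep.monomialRep ⟨_, hadm₁⟩ i) + ∑ j, KZ.of (IntegralRep.monomialRep ⟨_, hadm₂⟩ j)) -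
      (KZ.of (IntegralRep.ratPart ⟨_, hadm₁⟩) + ∑ i, KZ.of (IntegralRep.monomialRep ⟨_, hadm₁⟩ i)) -
      (KZ.of (IntegralRep.ratPart ⟨_, hadm₂⟩) + ∑ j, KZ.of (IntegralRep.monomialRep ⟨_, hadm₂⟩ j)) =
      KZ.of (IntegralRep.ratPart ⟨_, hadm⟩) - KZ.of (IntegralRep.ratPart ⟨_, hadm₁⟩) -
        KZ.of (IntegralRep.ratPart ⟨_, hadm₂⟩) := by abel
  rw [this]
  exact hrat

/-- **Rewrite (i), the product rule, unfolds into KZ relations** (`KZ.of_sub_of_sub_mem_relations_mul`).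
[Kontsevich–Zagier 2001, §1.1–1.2] [folklore] -/
theorem unfold_mem_of_mem_mulRel {c : FormalRep} (hc : c ∈ mulRel) : unfold c ∈ KZ.relations := by
  obtain ⟨n, k, σ, h₀, g, u, w, h, v, ⟨T, hadm⟩, ⟨T', hadm'⟩, hu, hw, hr, hr', rfl⟩ := hc
  obtain rfl : T = _ := hr
  obtain rfl : T' = _ := hr'
  simp only [map_sub, unfold_of]
  have hrp : IntegralRep.ratPart ⟨_, hadm'⟩ = IntegralRep.ratPart ⟨_, hadm⟩ := rfl
  have hcs : ∀ j : Fin k, IntegralRep.monomialRep ⟨_, hadm'⟩ (Fin.castSucc (Fin.castSucc j)) =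
      IntegralRep.monomialRep ⟨_, hadm⟩ (Fin.castSucc j) := fun j =>
    KZ.IntegralRep.ext' (by simp only [monomialRep_domain_mk, Fin.snoc_castSucc])
      (by simp only [monomialRep_integrand_mk, Fin.snoc_castSucc])
  have hσ : IsSemialgebraic ℚ σ := hadm.isSemialgebraic_domain
  have hu' : IsSemialgebraicFunOn ℚ σ u := by
    simpa using hadm'.isSemialgebraicFunOn_v (Fin.castSucc (Fin.last k))
  have hw' : IsSemialgebraicFunOn ℚ σ w := by
    simpa using hadm'.isSemialgebraicFunOn_v (Fin.last (k + 1))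
  have hmain : KZ.of (IntegralRep.monomialRep ⟨_, hadm⟩ (Fin.last k)) -
      KZ.of (IntegralRep.monomialRep ⟨_, hadm'⟩ (Fin.castSucc (Fin.last k))) -
      KZ.of (IntegralRep.monomialRep ⟨_, hadm'⟩ (Fin.last (k + 1))) ∈ KZ.relations :=
    KZ.of_sub_of_sub_mem_relations_mul (g := g) hσ hu' hw' hu hw _ _ _
      (by simp only [monomialRep_domain_mk, Fin.snoc_last]; rfl)
      (fun z _ => by simp only [monomialRep_integrand_mk, Fin.snoc_last])
      (by simp only [monomialRep_domain_mk, Fin.snoc_castSucc, Fin.snoc_last])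
      (fun z _ => by simp only [monomialRep_integrand_mk, Fin.snoc_castSucc, Fin.snoc_last])
      (by simp only [monomialRep_domain_mk, Fin.snoc_last])
      (fun z _ => by simp only [monomialRep_integrand_mk, Fin.snoc_last])
  rw [Fin.sum_univ_castSucc, Fin.sum_univ_castSucc, Fin.sum_univ_castSucc, hrp]
  simp only [hcs]
  have : KZ.of (IntegralRep.ratPart ⟨_, hadm⟩) +
      (∑ j : Fin k, KZ.of (IntegralRep.monomialRep ⟨_, hadm⟩ (Fin.castSucc j)) +
        KZ.of (IntegralRep.monomialRep ⟨_, hadm⟩ (Fin.last k))) -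
      (KZ.of (IntegralRep.ratPart ⟨_, hadm⟩) +
        (∑ j : Fin k, KZ.of (IntegralRep.monomialRep ⟨_, hadm⟩ (Fin.castSucc j)) +
          KZ.of (IntegralRep.monomialRep ⟨_, hadm'⟩ (Fin.castSucc (Fin.last k))) +
          KZ.of (IntegralRep.monomialRep ⟨_, hadm'⟩ (Fin.last (k + 1))))) =
      KZ.of (IntegralRep.monomialRep ⟨_, hadm⟩ (Fin.last k)) -
        KZ.of (IntegralRep.monomialRep ⟨_, hadm'⟩ (Fin.castSucc (Fin.last k))) -
        KZ.of (IntegralRep.monomialRep ⟨_, hadm'⟩ (Fin.last (k + 1))) := by abel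
  rw [this]
  exact hmain

/-- **Rewrite (ii), merging, unfolds into KZ relations**: integrand additivity
`(g + g')/s = g/s + g'/s` on the common band. [Kontsevich–Zagier 2001, §1.2, rule 1)] [folklore] -/
theorem unfold_mem_of_mem_mergeRel {c : FormalRep} (hc : c ∈ mergeRel) : unfold c ∈ KZ.relations := by
  obtain ⟨n, k, σ, h₀, g, g', u, h, v, ⟨T, hadm⟩, ⟨T', hadm'⟩, hr, hr', rfl⟩ := hc
  obtain rfl : T = _ := hr
  obtain rfl : T' = _ := hr'
  simp only [map_sub, unfold_of]
  have hrp : IntegralRep.ratPart ⟨_, hadm'⟩ = IntegralRep.ratPart ⟨_, hadm⟩ := rfl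
  have hcs : ∀ j : Fin k, IntegralRep.monomialRep ⟨_, hadm⟩ (Fin.castSucc (Fin.castSucc j)) =
      IntegralRep.monomialRep ⟨_, hadm'⟩ (Fin.castSucc j) := fun j =>
    KZ.IntegralRep.ext' (by simp only [monomialRep_domain_mk, Fin.snoc_castSucc])
      (by simp only [monomialRep_integrand_mk, Fin.snoc_castSucc])
  have hmain : KZ.of (IntegralRep.monomialRep ⟨_, hadm'⟩ (Fin.last k)) -
      KZ.of (IntegralRep.monomialRep ⟨_, hadm⟩ (Fin.castSucc (Fin.last k))) -
      KZ.of (IntegralRep.monomialRep ⟨_, hadm⟩ (Fin.last (k + 1))) ∈ KZ.relations :=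
    KZ.integrandAddRel_subset_relations ⟨n + 1, IntegralRep.monomialRep ⟨_, hadm'⟩ (Fin.last k),
      IntegralRep.monomialRep ⟨_, hadm⟩ (Fin.castSucc (Fin.last k)),
      IntegralRep.monomialRep ⟨_, hadm⟩ (Fin.last (k + 1)),
      by simp only [monomialRep_domain_mk, Fin.snoc_castSucc, Fin.snoc_last],
      by simp only [monomialRep_domain_mk, Fin.snoc_last],
      fun z _ => by
        simp only [monomialRep_integrand_mk, Fin.snoc_castSucc, Fin.snoc_last, Pi.add_apply]
        ring, rfl⟩
  rw [Fin.sum_univ_castSucc, Fin.sum_univ_castSucc, Fin.sum_univ_castSucc, hrp]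
  simp only [hcs]
  have : KZ.of (IntegralRep.ratPart ⟨_, hadm⟩) +
      (∑ j : Fin k, KZ.of (IntegralRep.monomialRep ⟨_, hadm'⟩ (Fin.castSucc j)) +
        KZ.of (IntegralRep.monomialRep ⟨_, hadm⟩ (Fin.castSucc (Fin.last k))) +
        KZ.of (IntegralRep.monomialRep ⟨_, hadm⟩ (Fin.last (k + 1)))) -
      (KZ.of (IntegralRep.ratPart ⟨_, hadm⟩) +
        (∑ j : Fin k, KZ.of (IntegralRep.monomialRep ⟨_, hadm'⟩ (Fin.castSucc j)) +
          KZ.of (IntegralRep.monomialRep ⟨_, hadm'⟩ (Fin.last k)))) =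
      -(KZ.of (IntegralRep.monomialRep ⟨_, hadm'⟩ (Fin.last k)) -
        KZ.of (IntegralRep.monomialRep ⟨_, hadm⟩ (Fin.castSucc (Fin.last k))) -
        KZ.of (IntegralRep.monomialRep ⟨_, hadm⟩ (Fin.last (k + 1)))) := by abel
  rw [this]
  exact KZ.relations.neg_mem hmain

/-- **Rewrite (iii), dropping a trivial monomial, unfolds into KZ relations**: the unfolded
monomial has a null domain (inside the hyperplane `s = 1`) when `u = 1` on `σ`, and a zero integrand
when `g = 0` on `σ`. [Kontsevich–Zagier 2001, §1.2, rule 1)] [folklore] -/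
theorem unfold_mem_of_mem_dropRel {c : FormalRep} (hc : c ∈ dropRel) : unfold c ∈ KZ.relations := by
  obtain ⟨n, k, σ, h₀, g, u, h, v, ⟨T, hadm⟩, ⟨T', hadm'⟩, hgu, hr, hr', rfl⟩ := hc
  obtain rfl : T = _ := hr
  obtain rfl : T' = _ := hr'
  simp only [map_sub, unfold_of]
  have hrp : IntegralRep.ratPart ⟨_, hadm'⟩ = IntegralRep.ratPart ⟨_, hadm⟩ := rfl
  have hcs : ∀ j : Fin k, IntegralRep.monomialRep ⟨_, hadm⟩ (Fin.castSucc j) =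
      IntegralRep.monomialRep ⟨_, hadm'⟩ j := fun j =>
    KZ.IntegralRep.ext' (by simp only [monomialRep_domain_mk, Fin.snoc_castSucc])
      (by simp only [monomialRep_integrand_mk, Fin.snoc_castSucc])
  have hmain : KZ.of (IntegralRep.monomialRep ⟨_, hadm⟩ (Fin.last k)) ∈ KZ.relations := by
    rcases hgu with hu | hg
    · refine KZ.of_mem_relations_of_volume_eq_zero _ (measure_mono_null (fun z hz => ?_)
        (KZ.volume_setOf_last_eq_zero (n := n) 1))
      simp only [monomialRep_domain_mk, Fin.snoc_last] at hz
      exact le_antisymm (hu _ hz.1 ▸ hz.2.2) hz.2.1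
    · refine KZ.of_mem_relations_of_eqOn_zero _ fun z hz => ?_
      simp only [monomialRep_domain_mk, Fin.snoc_last] at hz
      simp only [monomialRep_integrand_mk, Fin.snoc_last, hg _ hz.1, zero_div, Pi.zero_apply]
  rw [Fin.sum_univ_castSucc, hrp]
  simp only [hcs]
  have : KZ.of (IntegralRep.ratPart ⟨_, hadm⟩) +
      (∑ j : Fin k, KZ.of (IntegralRep.monomialRep ⟨_, hadm'⟩ j) +
        KZ.of (IntegralRep.monomialRep ⟨_, hadm⟩ (Fin.last k))) -
      (KZ.of (IntegralRep.ratPart ⟨_, hadm⟩) + ∑ j : Fin k, KZ.of (IntegralRep.monomialRep ⟨_, hadm'⟩ j)) =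
      KZ.of (IntegralRep.monomialRep ⟨_, hadm⟩ (Fin.last k)) := by abel
  rw [this]
  exact hmain

/-- **Rewrite (iv), modification off the domain, unfolds into KZ relations** (KZ congruence of the
rational parts and of each unfolded monomial). [Kontsevich–Zagier 2001, §1.2, rule 1)] [folklore] -/
theorem unfold_mem_of_mem_congrRel {c : FormalRep} (hc : c ∈ congrRel) : unfold c ∈ KZ.relations := by
  obtain ⟨n, k, σ, h₀, h₀', h, h', v, v', ⟨T, hadm⟩, ⟨T', hadm'⟩, hh₀, hh, hv, hr, hr', rfl⟩ := hc
  obtain rfl : T = _ := hr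
  obtain rfl : T' = _ := hr'
  simp only [map_sub, unfold_of]
  have hrat : KZ.of (IntegralRep.ratPart ⟨_, hadm⟩) - KZ.of (IntegralRep.ratPart ⟨_, hadm'⟩) ∈
      KZ.relations := KZ.of_sub_of_mem_relations_of_eqOn rfl hh₀
  have hmono : ∀ i : Fin k, KZ.of (IntegralRep.monomialRep ⟨_, hadm⟩ i) -
      KZ.of (IntegralRep.monomialRep ⟨_, hadm'⟩ i) ∈ KZ.relations := fun i =>
    KZ.of_sub_of_mem_relations_of_eqOn
      (by simp only [monomialRep_domain_mk]; exact (band_congr (hv i)).symm)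
      fun z hz => by
        simp only [monomialRep_domain_mk] at hz
        simp only [monomialRep_integrand_mk, hh i hz.1]
  have : KZ.of (IntegralRep.ratPart ⟨_, hadm⟩) + ∑ i, KZ.of (IntegralRep.monomialRep ⟨_, hadm⟩ i) -
      (KZ.of (IntegralRep.ratPart ⟨_, hadm'⟩) + ∑ i, KZ.of (IntegralRep.monomialRep ⟨_, hadm'⟩ i)) =
      (KZ.of (IntegralRep.ratPart ⟨_, hadm⟩) - KZ.of (IntegralRep.ratPart ⟨_, hadm'⟩)) +
        ∑ i : Fin k, (KZ.of (IntegralRep.monomialRep ⟨_, hadm⟩ i) -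
          KZ.of (IntegralRep.monomialRep ⟨_, hadm'⟩ i)) := by
    simp only [Finset.sum_sub_distrib]
    abel
  rw [this]
  exact KZ.relations.add_mem hrat (sum_mem fun i _ => hmono i)

/-- **Rewrite (v), re-indexing, unfolds to zero** (a finite sum is invariant under permutations).
[folklore] -/
theorem unfold_mem_of_mem_reindexRel {c : FormalRep} (hc : c ∈ reindexRel) :
    unfold c ∈ KZ.relations := by
  obtain ⟨n, k, σ, h₀, h, v, e, ⟨T, hadm⟩, ⟨T', hadm'⟩, hr, hr', rfl⟩ := hc
  obtain rfl : T = _ := hr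
  obtain rfl : T' = _ := hr'
  simp only [map_sub, unfold_of]
  have hrp : IntegralRep.ratPart ⟨_, hadm'⟩ = IntegralRep.ratPart ⟨_, hadm⟩ := rfl
  have hm : ∀ i : Fin k, IntegralRep.monomialRep ⟨_, hadm'⟩ i = IntegralRep.monomialRep ⟨_, hadm⟩ (e i) :=
    fun i => rfl
  simp only [hrp, hm]
  rw [Equiv.sum_comp e (fun i => KZ.of (IntegralRep.monomialRep ⟨_, hadm⟩ i)), sub_self]
  exact KZ.relations.zero_mem

/-- **Move (2), change of variables, unfolds into KZ relations**: the rational parts are a KZ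
change of variables verbatim, and each unfolded monomial is carried by the lifted map
`(x, s) ↦ (Φ x, s)` (`KZ.of_sub_of_mem_relations_covLift`). [Kontsevich–Zagier 2001, §1.2,
rule 2)] [folklore] -/
theorem unfold_mem_of_mem_changeOfVariablesRel {c : FormalRep} (hc : c ∈ changeOfVariablesRel) :
    unfold c ∈ KZ.relations := by
  obtain ⟨n, k, σ, Φ, Φ', h₀, h₀', h, h', v, v', ⟨T, hadm⟩, ⟨T', hadm'⟩, hΦ, hΦ', hinj, hh₀, hh, hv,
    hr, hr', rfl⟩ := hc
  obtain rfl : T = _ := hr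
  obtain rfl : T' = _ := hr'
  simp only [map_sub, unfold_of]
  have hrat : KZ.of (IntegralRep.ratPart ⟨_, hadm⟩) - KZ.of (IntegralRep.ratPart ⟨_, hadm'⟩) ∈
      KZ.relations :=
    KZ.changeOfVariablesRel_subset_relations ⟨n, _, _, Φ, Φ', hΦ, hΦ', hinj, rfl, hh₀, rfl⟩
  have hmono : ∀ i : Fin k, KZ.of (IntegralRep.monomialRep ⟨_, hadm⟩ i) -
      KZ.of (IntegralRep.monomialRep ⟨_, hadm'⟩ i) ∈ KZ.relations := fun i =>
    KZ.of_sub_of_mem_relations_covLift hΦ hΦ' hinj (hv i) _ _ rfl rfl fun z hz => by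
      simp only [monomialRep_domain_mk] at hz
      simp only [monomialRep_integrand_mk, Fin.init_snoc, Fin.snoc_last, hh i _ hz.1]
      ring
  have : KZ.of (IntegralRep.ratPart ⟨_, hadm⟩) + ∑ i, KZ.of (IntegralRep.monomialRep ⟨_, hadm⟩ i) -
      (KZ.of (IntegralRep.ratPart ⟨_, hadm'⟩) + ∑ i, KZ.of (IntegralRep.monomialRep ⟨_, hadm'⟩ i)) =
      (KZ.of (IntegralRep.ratPart ⟨_, hadm⟩) - KZ.of (IntegralRep.ratPart ⟨_, hadm'⟩)) +
        ∑ i : Fin k, (KZ.of (IntegralRep.monomialRep ⟨_, hadm⟩ i) -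
          KZ.of (IntegralRep.monomialRep ⟨_, hadm'⟩ i)) := by
    simp only [Finset.sum_sub_distrib]
    abel
  rw [this]
  exact KZ.relations.add_mem hrat (sum_mem fun i _ => hmono i)

/-- **Move (3), Newton–Leibniz with a primitive term, unfolds into KZ relations**: the rational
part of the band side splits as `[B, H₀'] + Σᵢ [B, Hᵢ Vᵢ'/Vᵢ]` (integrand additivity), `[B, H₀']`
and the rational part of the base side are a KZ Newton–Leibniz move verbatim, and for each monomial
the four representations `[B, Hᵢ Vᵢ'/Vᵢ]`, the unfolded `(Hᵢ', Vᵢ)` and the two unfolded boundary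
monomials form an unfolded logarithmic Stokes instance (`KZ.unfoldedLogStokes_mem_relations`).
[Kontsevich–Zagier 2001, §1.1–1.2] [folklore] -/
theorem unfold_mem_of_mem_newtonLeibnizRel {c : FormalRep} (hc : c ∈ newtonLeibnizRel) :
    unfold c ∈ KZ.relations := by
  obtain ⟨n, k, τ, a, b, H₀, H₀', H, H', V, V', ⟨T, hadm⟩, ⟨T', hadm'⟩, ha, hb, hab, hH₀, hH₀', hHV',
    hcont, hder, hintH₀', hintHV, hr, hr', rfl⟩ := hc
  obtain rfl : T = _ := hr
  obtain rfl : T' = _ := hr'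
  simp only [map_sub, unfold_of]
  have hB : IsSemialgebraic ℚ (band τ a b) := hadm.isSemialgebraic_domain
  have hτ : IsSemialgebraic ℚ τ := hadm'.isSemialgebraic_domain
  -- the pieces of the rational part of the band side
  let R₀ : KZ.IntegralRep (n + 1) := ⟨band τ a b, H₀', hB, hH₀', hintH₀'⟩
  let RB : Fin k → KZ.IntegralRep (n + 1) := fun i => ⟨band τ a b, fun z => H i z * V' i z / V i z, hB,
    IsSemialgebraicFunOn.div (IsSemialgebraicFunOn.mul_holds (hHV' i).1 (hHV' i).2)
      (hadm.isSemialgebraicFunOn_v i) fun z hz => (one_pos.trans_le (hadm.one_le_v i z hz)).ne',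
    hintHV i⟩
  have hsplit : KZ.of (IntegralRep.ratPart ⟨_, hadm⟩) - KZ.of R₀ - ∑ i, KZ.of (RB i) ∈ KZ.relations :=
    KZ.of_sub_of_sub_sum_mem_relations k _ R₀ RB rfl (fun _ => rfl) fun _ _ => rfl
  have hNL : KZ.of R₀ - KZ.of (IntegralRep.ratPart ⟨_, hadm'⟩) ∈ KZ.relations :=
    KZ.newtonLeibnizRel_subset_relations ⟨n, R₀, _, a, b, H₀, hH₀, ha, hb, hab, rfl,
      fun x hx => (hcont x hx).1, fun x hx t ht => (hder x hx t ht).1, fun _ _ => rfl, rfl⟩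
  -- the monomials
  have hmono : ∀ i : Fin k, KZ.of (RB i) + KZ.of (IntegralRep.monomialRep ⟨_, hadm⟩ i) -
      KZ.of (IntegralRep.monomialRep ⟨_, hadm'⟩ (Fin.castAdd k i)) -
      KZ.of (IntegralRep.monomialRep ⟨_, hadm'⟩ (Fin.natAdd k i)) ∈ KZ.relations := by
    intro i
    have hHb : IsSemialgebraicFunOn ℚ τ fun x => H i (Fin.snoc x (b x)) := by
      have h1 := hadm'.isSemialgebraicFunOn_h (Fin.castAdd k i)
      simp only [Fin.append_left] at h1
      exact h1
    have hVb : IsSemialgebraicFunOn ℚ τ fun x => V i (Fin.snoc x (b x)) := by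
      have h1 := hadm'.isSemialgebraicFunOn_v (Fin.castAdd k i)
      simp only [Fin.append_left] at h1
      exact h1
    have hHa : IsSemialgebraicFunOn ℚ τ fun x => H i (Fin.snoc x (a x)) := by
      have h1 := hadm'.isSemialgebraicFunOn_h (Fin.natAdd k i)
      simp only [Fin.append_right] at h1
      exact h1.neg.congr fun x _ => by simp
    have hVa : IsSemialgebraicFunOn ℚ τ fun x => V i (Fin.snoc x (a x)) := by
      have h1 := hadm'.isSemialgebraicFunOn_v (Fin.natAdd k i)
      simp only [Fin.append_right] at h1
      exact h1
    have hintb : IntegrableOn (fun x => H i (Fin.snoc x (b x)) *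
        Real.log (V i (Fin.snoc x (b x)))) τ := by
      have h1 := hadm'.integrableOn_monomial (Fin.castAdd k i)
      simp only [Fin.append_left] at h1
      exact h1
    have hinta : IntegrableOn (fun x => H i (Fin.snoc x (a x)) *
        Real.log (V i (Fin.snoc x (a x)))) τ := by
      have h1 := hadm'.integrableOn_monomial (Fin.natAdd k i)
      simp only [Fin.append_right] at h1
      simpa [neg_mul] using h1.neg
    exact KZ.unfoldedLogStokes_mem_relations hτ ha hb hab (hHV' i).1 (hadm.isSemialgebraicFunOn_h i)
      (hadm.isSemialgebraicFunOn_v i) (hHV' i).2 (hadm.one_le_v i) (fun x hx => (hcont x hx).2 i)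
      (fun x hx t ht => (hder x hx t ht).2 i) (hintHV i) (hadm.integrableOn_monomial i) hHb hVb hHa
      hVa hintb hinta (RB i) _ _ _ rfl (fun _ _ => rfl) rfl (fun _ _ => rfl)
      (by simp only [monomialRep_domain_mk, Fin.append_left])
      (fun z _ => by simp only [monomialRep_integrand_mk, Fin.append_left])
      (by simp only [monomialRep_domain_mk, Fin.append_right])
      (fun z _ => by simp only [monomialRep_integrand_mk, Fin.append_right])
  rw [Fin.sum_univ_add]
  have : KZ.of (IntegralRep.ratPart ⟨_, hadm⟩) + ∑ i, KZ.of (IntegralRep.monomialRep ⟨_, hadm⟩ i) -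
      (KZ.of (IntegralRep.ratPart ⟨_, hadm'⟩) +
        (∑ i : Fin k, KZ.of (IntegralRep.monomialRep ⟨_, hadm'⟩ (Fin.castAdd k i)) +
          ∑ i : Fin k, KZ.of (IntegralRep.monomialRep ⟨_, hadm'⟩ (Fin.natAdd k i)))) =
      (KZ.of (IntegralRep.ratPart ⟨_, hadm⟩) - KZ.of R₀ - ∑ i, KZ.of (RB i)) +
        (KZ.of R₀ - KZ.of (IntegralRep.ratPart ⟨_, hadm'⟩)) +
        ∑ i : Fin k, (KZ.of (RB i) + KZ.of (IntegralRep.monomialRep ⟨_, hadm⟩ i) -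
          KZ.of (IntegralRep.monomialRep ⟨_, hadm'⟩ (Fin.castAdd k i)) -
          KZ.of (IntegralRep.monomialRep ⟨_, hadm'⟩ (Fin.natAdd k i))) := by
    simp only [Finset.sum_sub_distrib, Finset.sum_add_distrib]
    abel
  rw [this]
  exact KZ.relations.add_mem (KZ.relations.add_mem hsplit hNL) (sum_mem fun i _ => hmono i)

/-- **`KZlog.Conservative` holds**: the logarithmic Kontsevich–Zagier calculus is conservative over
the ordinary one — a combination of monomial-free representations which is a logarithmic relation
is already a KZ relation. By the retraction criterion `KZlog.Conservative.of_unfold` it suffices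
that the unfolding of each of the nine generating moves is a KZ relation
(`unfold_mem_of_mem_*`). The statement is posed by route KontsevichZagierPeriods/LiouvilleUnfolding
(item LogCalculusConservative) and is not in print; the derivation is this project's, from
Kontsevich–Zagier's rules 1)–3) and the smoothness of semialgebraic functions off null sets.
[Kontsevich–Zagier 2001, §1.1–1.2] [folklore] -/
theorem Conservative_holds : Conservative := by
  refine Conservative.of_unfold fun c hc => ?_
  rcases hc with (((hc | hc) | ((((hc | hc) | hc) | hc) | hc)) | hc) | hc
  exacts [unfold_mem_of_mem_domainAddRel hc, unfold_mem_of_mem_termAddRel hc,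
    unfold_mem_of_mem_mulRel hc, unfold_mem_of_mem_mergeRel hc, unfold_mem_of_mem_dropRel hc,
    unfold_mem_of_mem_congrRel hc, unfold_mem_of_mem_reindexRel hc,
    unfold_mem_of_mem_changeOfVariablesRel hc, unfold_mem_of_mem_newtonLeibnizRel hc]

/-- Consequently the logarithmic relations are exactly the pull-back of the KZ relations along the
unfolding (`conservative_iff_eq_comap_unfold`). [folklore] -/
theorem relations_eq_comap_unfold : relations = KZ.relations.comap unfold :=
  conservative_iff_eq_comap_unfold.1 Conservative_holds

/-- Consequently the logarithmic kernel conjecture is EQUIVALENT to the ordinary one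
(`kzKernelConjecture_iff`). [folklore] -/
theorem kzKernelConjecture_iff_kernelConjecture :
    Transcendental.KZKernelConjecture ↔ KernelConjecture :=
  ⟨kernelConjecture_of_kzKernelConjecture, fun h => kzKernelConjecture_of_conservative Conservative_holds h⟩

end KZlog

end Literature.NumberTheory.Transcendental
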